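import Literature.MathematicalPhysics.QuantumFieldTheory.Balaban1983to89.B12Term286DifferentBlocks
import Literature.MathematicalPhysics.QuantumFieldTheory.Balaban1983to89.B12Term286SameBlock
import Literature.MathematicalPhysics.QuantumFieldTheory.Balaban1983to89.B12Decay510Lattice

/-!
# `Balaban1983to89.B12Display286RightMember` — T. Bałaban, *Renormalization group approach to lattice gauge field
theories. I. Generation of effective actions in a small field approximation and a coupling constant renormalization in
four dimensions*, Commun. Math. Phys. **109** (1987) 249–301 [Balaban1987RG1], p. 286: THE RIGHT MEMBER of the display
preceding (4.22) — the sizes, the tree-graph geometry behind *"δ₁ = O(M⁻¹)"*, the lattice sums `c₀(δ₁)`, `c₁(δ₁)` of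
(4.22), and the different-blocks case of the second sum of (4.21) END TO END

statement-level skeleton of published theorems with citation tags; proofs where landed; nothing here is a claim about
the Yang–Mills mass gap

PDF held: `paper:balaban1987-cmp109-rg-i-small-field` (journal page = PDF page + 248); pp. 257, 277, 285, 286 [PDF 9, 29,
37, 38] re-read for this module as images from
`run/shared/lean/pub/pub-balaban/b2b-balaban-ref1/pages/1987-cmp109-rg-I-small-field/1987-cmp109-rg-I-small-field-p009/p029/p037/p038-x2.png`.

CITATION HEADER / WHAT IS REPRODUCED (mega-formalization `lit-balaban`, HOME `run/shared/lean/pub/lit-balaban/`; unit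
`lit-balaban-p07` = Phase-2 proof seat p07, generation 10; free-target protocol G.5-34(d), TAKING line HOME/STATUS.md
2026-08-21T22:37:37Z; SKELETON rows `B12.Disp@286` (fold owner r20: «left member DERIVED, right member typed») and
`B12.Eq4.21-4.22` (shared id; r20 file of record `B12Sect4Statements`, p239748); complementary to r20 g11's
`B12Term286DifferentBlocks` (p307977: the LEFT member for the actual (4.3) terms) — referee ref-5).

p. 286 [PDF 38], verbatim: *"… There is a problem now, connected with the facts that the last factor (∂B_{μ₃})(Γ_{x,x₃})
is a function of two points instead of one, and it has the bound |(∂B_{μ₃})(Γ_{x,x₃})| < α₁(Lʲη)²|Γ_{x,x₃}|. The length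
|Γ_{x,x₃}| = |x₃ − x| is in ξ-scale, so it can be very big (of the order O(M(Lʲη)⁻¹) for points x, x₃ in □̃⁴, but far
apart. We have to use the exponential decay properties to get a proper bound. … A term corresponding to such a partition
can be estimated by
  Σ_{x,x₃} (8B₃ (1/α₂))⁴ E₀ exp(−κd_j(X) − δ₀ dist^{(ξ)}(X, x) − δ₀ dist^{(ξ)}(X, x₃)) |B|² |δB(x)| |(∂B)(Γ_{x,x₃})|
   < Σ_{x,x₃} (8B₃ (α₁/α₂))⁴ E₀ exp(−⅓κd_j(X) − δ₁|x − x₀| − δ₁|x₃ − x|) |x₃ − x| (Lʲη)⁵,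
where x₀ is a fixed point in X. The exponential decay factors with δ₁ are determined by the three factors on the
left-hand side, therefore the decay rate is rather poor, δ₁ = O(M⁻¹), because of the factor with κd_j(X). Summing over
x, x₃ we get finally the following estimate
  |(the second sum in (4.21))| ≦ (32B₃ (α₁/α₂) c₀(δ₁)c₁(δ₁))⁴ exp(−⅓κd_j(X)) (Lʲη)⁵,  (4.22)
hence this sum in (4.21) represents an irrelevant term."*  The size inputs, verbatim: p. 277 [PDF 29] *"By the definiton
of B and by the inequalities (3.32) we have |B| < O(1)Lʲη"*; (4.17) p. 285 [PDF 37] *"|(∂_νB_μ)(x)| < O(1)(α₂ +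
B₃O(1)Mα₀)(Lʲη)² < α₁(Lʲη)². … The inequalities (4.17), (4.18) hold for the field δB also."*; (4.21) p. 285: the split
*"B_{μ₃}(x₃) = B_{μ₃}(x) + (∂B_{μ₃})(Γ_{x,x₃})"*.  The geometry, p. 257 [PDF 9]: *"A length of a shortest graph in this
class, divided by M, is the linear size of X, and is denoted by d_j(X)."*

WHAT THIS MODULE DOES (imports r20's `B12Term286DifferentBlocks` (g11, p307977: `termEstimate286_differentBlocks`) and, since
v1.2, p05 g9's `B12Term286SameBlock` (p309645: `termEstimate286_sameBlock`) —
hence `B12Sect4Statements`: `PointData286`, `lhsSummand`/`rhsSummand` (+ `_eq`), `TermEstimate286Printed`,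
`display286_rhs_sum_le`, `sameBlock_product_le` — and the pub-balaban site-lattice geometry `B12Decay510Lattice` (`geomS`,
`geomLeafS`: cubes of side M on ℤᵈ, d_j = `TreeLength.treeLen`) with `B12Decay510Window.K₁` (the lattice constant
Σ_{z∈ℤᵈ}e^{−a|z|₁}); modifies nothing; THEOREMS ONLY — 0 definitions, 0 named facts; v1 p308530 = §§1–5 through
`differentBlocks_summed_lattice`, v1.1 p309034 = + §§6–7, v1.2 = + §8 the knit):

* §1 (S) THE SIZES.  `norm_sub_le_mul_l1` — the printed sentence *"it has the bound |(∂B_{μ₃})(Γ_{x,x₃})| <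
  α₁(Lʲη)²|Γ_{x,x₃}|"* from the pointwise (4.17): for a field `B` on the unit lattice with `‖B(y + e_ν) − B(y)‖ ≤ a` for
  all `y, ν`, the contour increment `(∂B)(Γ_{x,x₃}) = B(x₃) − B(x)` (the (4.21) split) obeys `‖B(x₃) − B(x)‖ ≤ a·|x₃ − x|₁`
  (`|Γ_{x,x₃}|` = the number of bonds of an axial contour = the ℓ¹ distance; telescoping); `sizes_product_le` —
  `|B|²|δB(x)||(∂B)(Γ_{x,x₃})| ≤ α₁⁴(Lʲη)⁵|x₃ − x|` from `|B|, |δB(x)| ≤ α₁Lʲη` and the contour bound.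
* §2 (G) THE GEOMETRY (*"The exponential decay factors with δ₁ are determined by the three factors on the left-hand
  side … δ₁ = O(M⁻¹), because of the factor with κd_j(X)"*).  `exponent286_of_leaf` — the real inequality behind the
  passage: if `|x − x₀| ≤ A·dist(X, x) + G`, `|x₃ − x| ≤ A·(dist(X, x) + dist(X, x₃)) + G` (the p. 257 geometry leaf with
  `x₀ ∈ X`), `2Aδ₁ ≤ δ₀` and `2δ₁G ≤ ⅔κd_j(X) + s`, then
  `⅓κd_j(X) + δ₁|x − x₀| + δ₁|x₃ − x| ≤ κd_j(X) + δ₀dist(X, x) + δ₀dist(X, x₃) + s`; `geometry286` — ON THE SITE LATTICE ℤᵈ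
  (cubes of side `M ≥ 1`, `X` a localization domain of a window `B`, `x₀` a site of a cube of `X`, `dist(X, ·)` the sup
  distance, `|·|` the ℓ¹ length): for EVERY `δ₁ ≥ 0` with `2dδ₁ ≤ δ₀` and `3dMδ₁ ≤ κ` the inequality holds with the explicit
  slack `s = 6dMδ₁` (from `B12Decay510Lattice.geomLeafS`: `dist_∞(x, y) ≤ dist_∞(x, X) + dist_∞(y, X) + M(d_j(X) + 3)`);
  `delta1_example` — the printed example shape: `δ₁ = min{δ₀, 2/(3M)}/(2d)` (*"δ₁ = O(M⁻¹)"*) satisfies both restrictions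
  once `κ ≥ 1`, with slack `6dMδ₁ ≤ 2`.
* §3 THE RIGHT MEMBER, pointwise and summed: `lhsSummand_le_exp_mul_rhsSummand` — over r20's abstract `PointData286`:
  (S) + (G) ⇒ `lhsSummand x x₃ ≤ eˢ · rhsSummand x x₃`; `sum_lhsSummand_le_exp_mul` — the display with the located factor
  `eˢ`: `Σ_{x,x₃} lhsSummand ≤ eˢ · Σ_{x,x₃} rhsSummand`.
* §4 (Σ) THE LATTICE SUMS OF (4.22) (*"Summing over x, x₃ we get finally"*): for every finite set `S` of sites, every
  `x₀`, every `a > 0`: `Σ_{x∈S} e^{−a|x − x₀|₁} ≤ K₁(d, a)` (`sum_exp_neg_l1_sub_le`) and `Σ_{x₃∈S} e^{−a|x₃ − x|₁}|x₃ − x|₁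
  ≤ (2/a)·K₁(d, a/2)` (`sum_exp_neg_l1_mul_le`, via r20's `sameBlock_product_le`) — i.e. `c₀(δ₁) := e^{6dMδ₁}K₁(d, δ₁)`,
  `c₁(δ₁) := (2/δ₁)K₁(d, δ₁/2)` are admissible lattice constants, uniform in the window and in `N = (Lʲη)⁻¹`.
* §5 (E) THE DIFFERENT-BLOCKS CASE END TO END on the site lattice: `sum_lhsSummand_le_lattice` — with the point
  functions of `D : PointData286 ↥S` THE LATTICE ONES (`dist^{(ξ)}(X, x)` = sup distance to `X`, `|x − x₀|`, `|x₃ − x|` =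
  ℓ¹, `d_j(X) = treeLen`), the sizes (S) and `δ₁ > 0` with the two restrictions:
  `Σ_{x,x₃} lhsSummand ≤ (8B₃α₁α₂⁻¹)⁴ E₀ c₀(δ₁) c₁(δ₁) e^{−⅓κd_j(X)} (Lʲη)⁵`; `differentBlocks_summed_lattice` — hence for
  every family `termQ` obeying r20's display shape `TermEstimate286Printed D termQ` (a THEOREM for the actual (4.3) terms
  since p307977): `‖Σ_{x,x₃} termQ x x₃‖ ≤ (8B₃α₁α₂⁻¹)⁴ E₀ c₀(δ₁) c₁(δ₁) e^{−⅓κd_j(X)} (Lʲη)⁵` — EXACTLY the per-term input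
  `hs` of r20's `secondSum_le_of_terms` / `kernelBound422_of_terms` ((4.22)), with NO display hypothesis and NO lattice-sum
  hypothesis left; **`secondSum_differentBlocks_actual`** (v1.1) — the same bound for the ACTUAL (4.3) terms
  `D^{|c|}𝐄(0)[⟨δ^{n(p)}𝐇(0), ⊗_{i∈N(p)}B_i⟩_p]` of a different-blocks partition `c`, r20 g11's `termEstimate286_differentBlocks`
  (p307977) composed in: the different-blocks family of (4.22) FROM THE PRINTED INPUTS ONLY — (4.4) + (1.18) for the outer
  function, [15] Prop. 9 analyticity/sup and the (190)-shape first-order localisation bounds for `𝐇_j(□₀, ·)`, the sizes,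
  `x₀ ∈ X`, `δ₁ = O(M⁻¹)` — no display, no lattice-sum, no block hypothesis.
* §6 (v1.1) `lhsSummand_le_rhsSummand_of_margin` / `sum_lhsSummand_le_sum_rhsSummand_of_margin` — THE DISPLAY AS PRINTED
  (non-strict) once the sizes carry the margin `e^{−s/4}` (`eˢα′⁴ ≤ α₁⁴`): the located factor is a restriction of the identical
  printed form on the unquantified `O(1)` of (4.17)'s *"O(1)(α₂ + B₃O(1)Mα₀) < α₁"*; `one_le_K₁`.
* §7 (v1.1) `secondSum_differentBlocks_actual` (above) and **`kernelBound422_actual_lattice`** — r20's decl of record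
  `KernelBound422Printed` ((4.22)) for the ACTUAL second sum of (4.21) with the p. 286 display and the lattice sums DERIVED
  (`c₀ = e^{6dMδ₁}K₁(d,δ₁)`, `c₁ = (2/δ₁)K₁(d,δ₁/2)`); residue exactly: the same-block terms ([15] Sect. G, `hsame`) and the
  bookkeeping `E₀ ≤ 1`, `δ₁ ≤ 2` of r20's `kernelBound422_of_terms`.
* §8 (v1.2) THE KNIT: `secondSum_sameBlock_actual` — the SAME-BLOCK family summed on the site lattice from the printed inputs only
  (p05 g9's `B12Term286SameBlock.termEstimate286_sameBlock`, p309645: the block `N(p) ∋ 0, 3` satisfies the p. 282 first-order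
  sentence twice, so a same-block term obeys the printed term estimate at rate `δ₀/2` — composed with §5 at the data
  `{D with δ₀ := δ₀/2}`, restriction `4dδ₁ ≤ δ₀`) = r20's `hsame` PROVED; **`kernelBound422_closed_lattice`** ((4.22) for the ACTUAL
  second sum, both families + right member + lattice sums derived, bookkeeping `E₀ ≤ 1`) and **`kernelBound422_closed_lattice_maxE₀`**
  (the same, `E₀`-FREE: `c₀(δ₁) := max{1,E₀}·e^{6dMδ₁}K₁(d,δ₁)`, via r20 g12's `kernelBound422_of_terms_maxE₀` pasted here) — NO display,
  lattice-sum, per-partition or `E₀ ≤ 1` hypothesis remains.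

HONEST SCOPE / DIVERGENCE (located, recorded in the cell's GAPS.md as G-B12-06 by this unit).  (1) THE CONSTANT: summand
by summand the printed display needs a factor `eˢ`, `s = O(Mδ₁) = O(1)` — for `X` a single cube (`d_j(X) = 0`, `M ≥ 2`),
`x₀ ∈ X` and two further sites `x ≠ x₃` of `X`, the left exponent is `0` while the right one is `−δ₁(|x − x₀| + |x₃ − x|) < 0`,
and the sizes may come arbitrarily close to saturation, so the left summand can exceed the right one; print displays no
constant (it writes `<` with the bare `(8B₃α₁α₂⁻¹)⁴`).  Here the slack is explicit, `s = 6dMδ₁` (`≤ 2` for the example δ₁), and is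
FOLDED INTO `c₀(δ₁)`, whose value print never gives (*"c₀(δ₁)c₁(δ₁)"* is all that is printed) — so (4.22) is reached in
r20's currency with admissible explicit `c₀, c₁`; the literal strict display `Display286Printed` is NOT claimed.  (2) THE
SIZES `|B|, |δB(x)| ≤ α₁Lʲη` are the p. 277 / (4.17)-level inputs (*"|B| < O(1)Lʲη"*, *"hold for the field δB also"*; the
passage LHS → RHS uses exactly `|B|²|δB||(∂B)(Γ)| ≤ α₁⁴(Lʲη)⁵|x₃ − x|`) and enter as hypotheses in printed shape; the contour
bound is DERIVED from the pointwise (4.17) (§1).  (3) METRICS (cell DIVERGENCE D-b03.29/D-b03.14 of the pub-balaban lattice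
lineage): `T` = the site lattice ℤᵈ in ξ-units with cubes of side `M` (window model, `B12Decay510Lattice`); `dist^{(ξ)}(X,·)`
is read as the SUP distance (the weakest reading for an INPUT decay — sup ≤ Euclidean), `|x − x₀|`, `|x₃ − x| = |Γ_{x,x₃}|`
as ℓ¹ lengths (the length of an axial contour; ℓ¹ ≥ Euclidean, the strongest reading for the OUTPUT decay), whence the
factor `d` in the two restrictions `2dδ₁ ≤ δ₀`, `3dMδ₁ ≤ κ` (print: *"δ₁ = O(M⁻¹)"*, d = 4).  (4) THE SAME-BLOCK CASE enters (§8,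
v1.2) by p05 g9's half-rate Cauchy route (first-order localisation twice), NOT by print's [15] Sect. G tree factor
`e^{−δ₀|x₃ − x|}` (r20's hypothesis shape `SameBlockFactor286Printed`, cell GAPS G-B11-G2a — untouched, and not needed for (4.22));
the row heads are the owners' call; NOT HERE: the words *"represents an irrelevant term"* ((0.28)/(3.35) bookkeeping).  Every declaration below is a theorem proved in this file; axioms standard.
-/

noncomputable section

open Set Metric Finset
open scoped BigOperators

namespace Literature.MathematicalPhysics.QuantumFieldTheory.Balaban1983to89.B12Display286RightMember

open Literature.MathematicalPhysics.QuantumFieldTheory.Balaban1983to89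
open B12Sect4Statements B12Sec2to5 B13ScaleTransfer TreeLength TreeLengthCubeSystem B12Decay510Lattice
  B12Decay510Window B12Term286DifferentBlocks B12Repr43 B12Term286SameBlock

variable {d M : ℕ}

/-! ## §1 (S). The sizes: the contour bound from the pointwise (4.17), and the product of the four sizes -/

/-- [folklore] The cast of `Int.natAbs` to `ℝ` is the absolute value. -/
private theorem cast_natAbs_eq_abs (k : ℤ) : ((k.natAbs : ℕ) : ℝ) = |(k : ℝ)| := by
  rw [← Int.cast_natCast, Int.natCast_natAbs, Int.cast_abs]

/-- The ℓ¹ length is at most `d` times the sup distance of the unit lattice `T₁^{(j)}` (the conversion used to read the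
printed `|x − x₀|`, `|x₃ − x|` of p. 286 in the ℓ¹ (contour-length) currency against the sup-metric geometry leaf).
[cite: Balaban1987RG1, p.286] -/
theorem l1_sub_le_mul_dist (x y : Pt d) : l1 (x - y) ≤ d * dist x y := by
  unfold l1
  calc ∑ μ, |((x - y) μ : ℝ)| ≤ ∑ _μ : Fin d, dist x y := Finset.sum_le_sum fun μ _ => by
        rw [Pi.sub_apply, Int.cast_sub, ← Real.dist_eq, Int.dist_cast_real]
        exact dist_le_pi_dist x y μ
    _ = d * dist x y := by simp

/-- **p. 286: *"the last factor (∂B_{μ₃})(Γ_{x,x₃}) … has the bound |(∂B_{μ₃})(Γ_{x,x₃})| < α₁(Lʲη)²|Γ_{x,x₃}|"*,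
from the pointwise (4.17).**  For a field `B` on the unit lattice (values in any seminormed group) whose unit-lattice
derivatives are bounded, `‖B(y + e_ν) − B(y)‖ ≤ a` for all sites `y` and directions `ν` ((4.17): `a = α₁(Lʲη)²`), the
contour increment `(∂B)(Γ_{x,x₃}) = B(x₃) − B(x)` of the (4.21) split *"B_{μ₃}(x₃) = B_{μ₃}(x) + (∂B_{μ₃})(Γ_{x,x₃})"*
satisfies `‖B(x₃) − B(x)‖ ≤ a·|x₃ − x|₁`, `|x₃ − x|₁ = |Γ_{x,x₃}|` the number of bonds of an axial contour from `x` to `x₃`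
(telescoping along the contour). [cite: Balaban1987RG1, p.286; (4.17) p.285; (4.21) p.285] -/
theorem norm_sub_le_mul_l1 {V : Type*} [SeminormedAddCommGroup V] (B : Pt d → V) {a : ℝ}
    (h : ∀ (y : Pt d) (ν : Fin d), ‖B (y + Pi.single ν 1) - B y‖ ≤ a) (x x₃ : Pt d) :
    ‖B x₃ - B x‖ ≤ a * l1 (x₃ - x) := by
  suffices H : ∀ (N : ℕ) (y : Pt d), ∑ μ, ((y - x) μ).natAbs = N → ‖B y - B x‖ ≤ a * N by
    have hcast : ((∑ μ, ((x₃ - x) μ).natAbs : ℕ) : ℝ) = l1 (x₃ - x) := by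
      unfold l1
      push_cast
      exact Finset.sum_congr rfl fun μ _ => cast_natAbs_eq_abs _
    have := H _ x₃ rfl
    rwa [hcast] at this
  intro N
  induction N with
  | zero =>
    intro y hy
    have hyx : y = x := by
      funext μ
      have h0 : ((y - x) μ).natAbs = 0 := (Finset.sum_eq_zero_iff.1 hy) μ (Finset.mem_univ μ)
      have h1 := Int.natAbs_eq_zero.1 h0
      rw [Pi.sub_apply] at h1
      exact sub_eq_zero.1 h1
    subst hyx
    simp
  | succ N ih =>
    intro y hy
    obtain ⟨μ, -, hμ⟩ : ∃ μ ∈ (Finset.univ : Finset (Fin d)), ((y - x) μ).natAbs ≠ 0 :=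
      Finset.exists_ne_zero_of_sum_ne_zero (by rw [hy]; exact Nat.succ_ne_zero N)
    have hk : (y - x) μ ≠ 0 := fun h0 => hμ (by rw [h0]; rfl)
    have hsplit : ∀ z : Pt d, ∑ ν, ((z - x) ν).natAbs =
        ((z - x) μ).natAbs + ∑ ν ∈ Finset.univ.erase μ, ((z - x) ν).natAbs :=
      fun z => (Finset.add_sum_erase _ _ (Finset.mem_univ μ)).symm
    -- one axial step of the contour from `y` towards `x`
    have hcore : ∀ y' : Pt d, (∀ ν, ν ≠ μ → (y' - x) ν = (y - x) ν) →
        ((y' - x) μ).natAbs + 1 = ((y - x) μ).natAbs → ‖B y - B y'‖ ≤ a → ‖B y - B x‖ ≤ a * ((N + 1 : ℕ) : ℝ) := by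
      intro y' hoff hμ' hstep
      have hoff' : ∀ ν ∈ Finset.univ.erase μ, ((y' - x) ν).natAbs = ((y - x) ν).natAbs := by
        intro ν hν
        rw [hoff ν (Finset.ne_of_mem_erase hν)]
      have hmeas : ∑ ν, ((y' - x) ν).natAbs = N := by
        have e1 := hsplit y'
        rw [Finset.sum_congr rfl hoff'] at e1
        have e2 := hsplit y
        omega
      calc ‖B y - B x‖ ≤ ‖B y - B y'‖ + ‖B y' - B x‖ := norm_sub_le_norm_sub_add_norm_sub _ _ _
        _ ≤ a + a * N := add_le_add hstep (ih y' hmeas)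
        _ = a * ((N + 1 : ℕ) : ℝ) := by push_cast; ring
    rcases lt_or_gt_of_ne hk with hneg | hpos
    · -- `(y − x)_μ < 0`: step to `y' = y + e_μ`
      refine hcore (y + Pi.single μ 1) (fun ν hν => ?_) ?_ ?_
      · simp [hν]
      · have e : (y + (Pi.single μ 1 : Pt d) - x) μ = (y - x) μ + 1 := by simp; ring
        rw [e]
        omega
      · rw [norm_sub_rev]
        exact h y μ
    · -- `(y − x)_μ > 0`: step to `y' = y − e_μ`, `y = y' + e_μ`
      refine hcore (y - Pi.single μ 1) (fun ν hν => ?_) ?_ ?_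
      · simp [hν]
      · have e : (y - (Pi.single μ 1 : Pt d) - x) μ = (y - x) μ - 1 := by simp; ring
        rw [e]
        omega
      · have e : y = (y - (Pi.single μ 1 : Pt d)) + Pi.single μ 1 := by simp
        have h' := h (y - Pi.single μ 1) μ
        rw [← e] at h'
        exact h'

/-- **The three sizes of the left member multiply to the right member's `α₁⁴(Lʲη)⁵|x₃ − x|`**: with `|B| ≤ α₁Lʲη`
(p. 277 *"|B| < O(1)Lʲη"*), `|δB(x)| ≤ α₁Lʲη` ((4.17) *"hold for the field δB also"*) and the contour bound
`|(∂B)(Γ_{x,x₃})| ≤ α₁(Lʲη)²|x₃ − x|`: `|B|²|δB(x)||(∂B)(Γ_{x,x₃})| ≤ α₁⁴(Lʲη)⁵|x₃ − x|`.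
[cite: Balaban1987RG1, p.286; p.277; (4.17) p.285] -/
theorem sizes_product_le {nB dB dG α₁ Λ ℓ : ℝ} (hnB : 0 ≤ nB) (hnB' : nB ≤ α₁ * Λ)
    (hdB' : dB ≤ α₁ * Λ) (hdG : 0 ≤ dG) (hdG' : dG ≤ α₁ * Λ ^ 2 * ℓ) :
    dB * nB * nB * dG ≤ α₁ ^ 4 * Λ ^ 5 * ℓ := by
  have hαΛ : 0 ≤ α₁ * Λ := hnB.trans hnB'
  have h1 : dB * nB * nB ≤ (α₁ * Λ) * (α₁ * Λ) * (α₁ * Λ) :=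
    mul_le_mul (mul_le_mul hdB' hnB' hnB hαΛ) hnB' hnB (mul_nonneg hαΛ hαΛ)
  calc dB * nB * nB * dG ≤ (α₁ * Λ) * (α₁ * Λ) * (α₁ * Λ) * (α₁ * Λ ^ 2 * ℓ) :=
      mul_le_mul h1 hdG' hdG (mul_nonneg (mul_nonneg hαΛ hαΛ) hαΛ)
    _ = α₁ ^ 4 * Λ ^ 5 * ℓ := by ring

/-! ## §2 (G). The geometry: *"The exponential decay factors with δ₁ are determined by the three factors on the
left-hand side, therefore the decay rate is rather poor, δ₁ = O(M⁻¹), because of the factor with κd_j(X)"* -/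

/-- **The real inequality behind the passage from the left to the right exponent of the p. 286 display.**  With
`t = d_j(X) ≥ 0`, the distances `Dx = dist^{(ξ)}(X, x) ≥ 0`, `D3 = dist^{(ξ)}(X, x₃) ≥ 0`, the lengths `ρ0 = |x − x₀|`,
`ρ3 = |x₃ − x|` controlled by the geometry leaf of p. 257 (`x₀ ∈ X`: `ρ0 ≤ A·Dx + G`, `ρ3 ≤ A·(Dx + D3) + G`, `G` =
the diameter term `M(d_j(X) + O(1))` in the chosen length currency, `A ≥ 0` the currency conversion), and a rate
`δ₁ ≥ 0` *"determined by the three factors"*: `2Aδ₁ ≤ δ₀` and `2δ₁G ≤ ⅔κt + s`, one has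
`⅓κt + δ₁ρ0 + δ₁ρ3 ≤ κt + δ₀Dx + δ₀D3 + s`. [cite: Balaban1987RG1, p.286; §0 p.257] -/
theorem exponent286_of_leaf {κ δ₀ δ₁ t Dx D3 ρ0 ρ3 A G s : ℝ} (hDx : 0 ≤ Dx) (hD3 : 0 ≤ D3)
    (hδ₁ : 0 ≤ δ₁) (hA : 0 ≤ A) (hρ0 : ρ0 ≤ A * Dx + G) (hρ3 : ρ3 ≤ A * (Dx + D3) + G)
    (h1 : 2 * A * δ₁ ≤ δ₀) (h2 : 2 * δ₁ * G ≤ 2 / 3 * κ * t + s) :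
    κ / 3 * t + δ₁ * ρ0 + δ₁ * ρ3 ≤ κ * t + δ₀ * Dx + δ₀ * D3 + s := by
  have e0 := mul_le_mul_of_nonneg_left hρ0 hδ₁
  rw [show δ₁ * (A * Dx + G) = A * δ₁ * Dx + δ₁ * G by ring] at e0
  have e3 := mul_le_mul_of_nonneg_left hρ3 hδ₁
  rw [show δ₁ * (A * (Dx + D3) + G) = A * δ₁ * Dx + A * δ₁ * D3 + δ₁ * G by ring] at e3
  have hAδ : 0 ≤ A * δ₁ := mul_nonneg hA hδ₁
  have hδ₀ : 0 ≤ δ₀ := by linarith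
  have f1 : 2 * (A * δ₁) * Dx ≤ δ₀ * Dx := mul_le_mul_of_nonneg_right (by linarith) hDx
  have f2 : A * δ₁ * D3 ≤ δ₀ * D3 := mul_le_mul_of_nonneg_right (by linarith) hD3
  linarith

/-- On the site lattice a site of a cube of the domain `X` is at sup distance `0` from `X`
(`B12Decay510Lattice.geomS`: dist(x, X) = min over the cubes of `X` of the sup distance to the cube).
[cite: Balaban1987RG1, §0 p.257] -/
theorem distD_eq_zero_of_mem (hM : 0 < M) (B : Finset (Pt d)) (X : Dom B) {x₀ : Pt d}
    (hx₀ : cubeOf M x₀ ∈ X.1) : (geomS B M).distD x₀ X = 0 := by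
  apply le_antisymm _ ((geomS B M).distD_nonneg x₀ X)
  rw [geomS_distD]
  calc distCubeS M x₀ (nearS M B x₀ X) ≤ distCubeS M x₀ (cubeOf M x₀) := nearS_le M B x₀ X hx₀
    _ ≤ dist x₀ x₀ := distCubeS_le_dist hM rfl x₀
    _ = 0 := dist_self _

/-- **p. 286, the geometry behind *"δ₁ = O(M⁻¹)"*, ON THE SITE LATTICE.**  Sites `x, x₃ ∈ ℤᵈ` (the unit lattice
`T₁^{(j)}` in ξ-units), cubes of side `M ≥ 1`, `X` a localization domain (a face-connected family of cubes of a window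
`B`), `x₀` *"a fixed point in X"* (a site of a cube of `X`), `dist^{(ξ)}(X, ·)` the sup distance to `X`, `|·|₁` the ℓ¹
length, `d_j(X)` = `treeLen` (p. 257).  For EVERY rate `δ₁ ≥ 0` with `2dδ₁ ≤ δ₀` and `3dMδ₁ ≤ κ`:
`⅓κd_j(X) + δ₁|x − x₀|₁ + δ₁|x₃ − x|₁ ≤ κd_j(X) + δ₀dist^{(ξ)}(X, x) + δ₀dist^{(ξ)}(X, x₃) + 6dMδ₁` — the three factors of the
left member dominate the three of the right member up to the explicit slack `6dMδ₁ = O(Mδ₁)` (from the p. 257 leaf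
`dist_∞(x, y) ≤ dist_∞(x, X) + dist_∞(y, X) + M(d_j(X) + 3)`, `B12Decay510Lattice.geomLeafS`).
[cite: Balaban1987RG1, p.286; §0 p.257] -/
theorem geometry286 (hM : 0 < M) (B : Finset (Pt d)) (X : Dom B) {x₀ : Pt d} (hx₀ : cubeOf M x₀ ∈ X.1)
    {κ δ₀ δ₁ : ℝ} (hδ₁ : 0 ≤ δ₁) (h1 : 2 * d * δ₁ ≤ δ₀) (h2 : 3 * d * M * δ₁ ≤ κ) (x x₃ : Pt d) :
    κ / 3 * treeLen X.1 + δ₁ * l1 (x - x₀) + δ₁ * l1 (x₃ - x) ≤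
      κ * treeLen X.1 + δ₀ * (geomS B M).distD x X + δ₀ * (geomS B M).distD x₃ X + 6 * d * M * δ₁ := by
  have hleaf := geomLeafS B hM
  have ht : 0 ≤ treeLen X.1 := treeLen_nonneg X.1
  have hDx := (geomS B M).distD_nonneg x X
  have hD3 := (geomS B M).distD_nonneg x₃ X
  have hx0 : dist x x₀ ≤ (geomS B M).distD x X + (M : ℝ) * (treeLen X.1 + 3) := by
    have := hleaf X x x₀
    rw [distD_eq_zero_of_mem hM B X hx₀, add_zero] at this
    simpa only [sys_dj] using this
  have hx3 : dist x x₃ ≤ (geomS B M).distD x X + (geomS B M).distD x₃ X + (M : ℝ) * (treeLen X.1 + 3) := by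
    simpa only [sys_dj] using hleaf X x x₃
  have hd : (0 : ℝ) ≤ d := Nat.cast_nonneg d
  have hρ0 : l1 (x - x₀) ≤ d * (geomS B M).distD x X + d * ((M : ℝ) * (treeLen X.1 + 3)) := by
    have := mul_le_mul_of_nonneg_left hx0 hd
    linarith [l1_sub_le_mul_dist x x₀]
  have hρ3 : l1 (x₃ - x) ≤ d * ((geomS B M).distD x X + (geomS B M).distD x₃ X) +
      d * ((M : ℝ) * (treeLen X.1 + 3)) := by
    have := mul_le_mul_of_nonneg_left hx3 hd
    rw [l1_sub_comm]
    linarith [l1_sub_le_mul_dist x x₃]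
  refine exponent286_of_leaf hDx hD3 hδ₁ hd hρ0 hρ3 (by linarith) ?_
  have h2t : 3 * d * M * δ₁ * treeLen X.1 ≤ κ * treeLen X.1 := mul_le_mul_of_nonneg_right h2 ht
  nlinarith [h2t]

/-- **The printed example shape of the rate, *"δ₁ = O(M⁻¹)"***: `δ₁ := min{δ₀, 2/(3M)}/(2d)` is positive, satisfies the
two restrictions of `geometry286` — `2dδ₁ ≤ δ₀` and, once `κ ≥ 1` (p. 257: κ *"sufficiently large"*), `3dMδ₁ ≤ κ` — and makes
the slack absolute: `6dMδ₁ ≤ 2` (so the located factor is at most `e²`).  (Cf. the tree's `B12Decay510.delta1` = the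
example `½min{δ₀, κM⁻¹}` printed for (5.10) p. 293.) [cite: Balaban1987RG1, p.286; (5.10) p.293] -/
theorem delta1_example (hd : 0 < d) (hM : 0 < M) {δ₀ κ : ℝ} (hδ₀ : 0 < δ₀) (hκ : 1 ≤ κ) :
    0 < min δ₀ (2 / (3 * M)) / (2 * d) ∧ 2 * d * (min δ₀ (2 / (3 * M)) / (2 * d)) ≤ δ₀ ∧
      3 * d * M * (min δ₀ (2 / (3 * M)) / (2 * d)) ≤ κ ∧ 6 * d * M * (min δ₀ (2 / (3 * M)) / (2 * d)) ≤ 2 := by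
  have hd' : (0 : ℝ) < d := Nat.cast_pos.2 hd
  have hM' : (0 : ℝ) < M := Nat.cast_pos.2 hM
  have hm0 : 0 < min δ₀ (2 / (3 * M)) := lt_min hδ₀ (by positivity)
  have hmδ : min δ₀ (2 / (3 * M)) ≤ δ₀ := min_le_left _ _
  have hmM : min δ₀ (2 / (3 * M)) ≤ 2 / (3 * M) := min_le_right _ _
  have hmM' : 3 * M * min δ₀ (2 / (3 * M)) ≤ 2 := by
    have := mul_le_mul_of_nonneg_left hmM (by positivity : (0 : ℝ) ≤ 3 * M)
    rwa [mul_div_cancel₀ _ (by positivity : (3 : ℝ) * M ≠ 0)] at this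
  refine ⟨by positivity, ?_, ?_, ?_⟩
  · rw [mul_div_cancel₀ _ (by positivity : (2 : ℝ) * d ≠ 0)]
    exact hmδ
  · calc 3 * d * M * (min δ₀ (2 / (3 * M)) / (2 * d)) = 3 * M * min δ₀ (2 / (3 * M)) / 2 := by
          rw [show (3 : ℝ) * d * M * (min δ₀ (2 / (3 * M)) / (2 * d)) =
            3 * M * min δ₀ (2 / (3 * M)) / 2 * (d / d) by ring, div_self hd'.ne', mul_one]
      _ ≤ 1 := by linarith
      _ ≤ κ := hκ
  · calc 6 * d * M * (min δ₀ (2 / (3 * M)) / (2 * d)) = 3 * M * min δ₀ (2 / (3 * M)) := by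
          rw [show (6 : ℝ) * d * M * (min δ₀ (2 / (3 * M)) / (2 * d)) =
            3 * M * min δ₀ (2 / (3 * M)) * (d / d) by ring, div_self hd'.ne', mul_one]
      _ ≤ 2 := hmM'

/-! ## §3. The right member of the p. 286 display, pointwise and summed, over r20's `PointData286` -/

/-- **The right member of the p. 286 display, DERIVED summand by summand** (with the located factor `eˢ`).  Over r20's
abstract point data: the sizes (S) — `|B| ≤ α₁Lʲη`, `|δB(x)| ≤ α₁Lʲη`, `|(∂B)(Γ_{x,x₃})| ≤ α₁(Lʲη)²|x₃ − x|` — and the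
geometry (G) in its concluded shape `⅓κd_j(X) + δ₁|x − x₀| + δ₁|x₃ − x| ≤ κd_j(X) + δ₀dist(X, x) + δ₀dist(X, x₃) + s` give
`(8B₃α₂⁻¹)⁴E₀e^{−κd_j(X) − δ₀dist(X,x) − δ₀dist(X,x₃)}|B|²|δB(x)||(∂B)(Γ_{x,x₃})| ≤
 eˢ · (8B₃α₁α₂⁻¹)⁴E₀e^{−⅓κd_j(X) − δ₁|x−x₀| − δ₁|x₃−x|}|x₃ − x|(Lʲη)⁵`. [cite: Balaban1987RG1, p.286] -/
theorem lhsSummand_le_exp_mul_rhsSummand {P : Type*} (D : PointData286 P) {s : ℝ} (x x₃ : P)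
    (hE₀ : 0 ≤ D.E₀) (hnormB : 0 ≤ D.normB) (hnormB' : D.normB ≤ D.α₁ * D.Ljη)
    (hδB : 0 ≤ D.δB x) (hδB' : D.δB x ≤ D.α₁ * D.Ljη)
    (hdBΓ : 0 ≤ D.dBΓ x x₃) (hdBΓ' : D.dBΓ x x₃ ≤ D.α₁ * D.Ljη ^ 2 * D.len x x₃)
    (hgeom : D.κ / 3 * D.djX + D.δ₁ * D.dist0 x + D.δ₁ * D.len x x₃ ≤
      D.κ * D.djX + D.δ₀ * D.distX x + D.δ₀ * D.distX x₃ + s) :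
    D.lhsSummand x x₃ ≤ Real.exp s * D.rhsSummand x x₃ := by
  rw [D.lhsSummand_eq, D.rhsSummand_eq]
  have hexp : Real.exp (-(D.κ * D.djX)) * (Real.exp (-(D.δ₀ * D.distX x)) * Real.exp (-(D.δ₀ * D.distX x₃))) ≤
      Real.exp s * (Real.exp (-(1 / 3 * D.κ * D.djX)) *
        (Real.exp (-(D.δ₁ * D.dist0 x)) * Real.exp (-(D.δ₁ * D.len x x₃)))) := by
    simp only [← Real.exp_add]
    exact Real.exp_le_exp.2 (by linarith)
  have hsz : D.δB x * D.normB * D.normB * D.dBΓ x x₃ ≤ D.α₁ ^ 4 * D.Ljη ^ 5 * D.len x x₃ :=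
    sizes_product_le hnormB hnormB' hδB' hdBΓ hdBΓ'
  have h8 : 0 ≤ (8 * D.B₃ / D.α₂) ^ 4 := Even.pow_nonneg ⟨2, rfl⟩ _
  have hP : 0 ≤ D.δB x * D.normB * D.normB * D.dBΓ x x₃ :=
    mul_nonneg (mul_nonneg (mul_nonneg hδB hnormB) hnormB) hdBΓ
  calc D.E₀ * Real.exp (-(D.κ * D.djX)) * (8 * D.B₃ / D.α₂) ^ 4 *
        (Real.exp (-(D.δ₀ * D.distX x)) * Real.exp (-(D.δ₀ * D.distX x₃))) *
        (D.δB x * D.normB * D.normB * D.dBΓ x x₃)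
      = D.E₀ * (8 * D.B₃ / D.α₂) ^ 4 *
          (Real.exp (-(D.κ * D.djX)) * (Real.exp (-(D.δ₀ * D.distX x)) * Real.exp (-(D.δ₀ * D.distX x₃)))) *
          (D.δB x * D.normB * D.normB * D.dBΓ x x₃) := by ring
    _ ≤ D.E₀ * (8 * D.B₃ / D.α₂) ^ 4 *
          (Real.exp s * (Real.exp (-(1 / 3 * D.κ * D.djX)) *
            (Real.exp (-(D.δ₁ * D.dist0 x)) * Real.exp (-(D.δ₁ * D.len x x₃))))) *
          (D.α₁ ^ 4 * D.Ljη ^ 5 * D.len x x₃) :=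
        mul_le_mul (mul_le_mul_of_nonneg_left hexp (mul_nonneg hE₀ h8)) hsz hP (by positivity)
    _ = Real.exp s * ((8 * D.B₃ * (D.α₁ / D.α₂)) ^ 4 * D.E₀ * Real.exp (-(1 / 3 * D.κ * D.djX)) * D.Ljη ^ 5 *
          (Real.exp (-(D.δ₁ * D.dist0 x)) * (Real.exp (-(D.δ₁ * D.len x x₃)) * D.len x x₃))) := by ring

/-- **The p. 286 display with the located factor**: under the pointwise sizes (S) and geometry (G) at every `(x, x₃)`,
`Σ_{x,x₃} lhsSummand ≤ eˢ · Σ_{x,x₃} rhsSummand` (print: `<` with no factor displayed; `s = O(Mδ₁)`).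
[cite: Balaban1987RG1, p.286] -/
theorem sum_lhsSummand_le_exp_mul {P : Type*} [Fintype P] (D : PointData286 P) {s : ℝ}
    (hE₀ : 0 ≤ D.E₀) (hnormB : 0 ≤ D.normB) (hnormB' : D.normB ≤ D.α₁ * D.Ljη)
    (hδB : ∀ x, 0 ≤ D.δB x) (hδB' : ∀ x, D.δB x ≤ D.α₁ * D.Ljη)
    (hdBΓ : ∀ x x₃, 0 ≤ D.dBΓ x x₃) (hdBΓ' : ∀ x x₃, D.dBΓ x x₃ ≤ D.α₁ * D.Ljη ^ 2 * D.len x x₃)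
    (hgeom : ∀ x x₃, D.κ / 3 * D.djX + D.δ₁ * D.dist0 x + D.δ₁ * D.len x x₃ ≤
      D.κ * D.djX + D.δ₀ * D.distX x + D.δ₀ * D.distX x₃ + s) :
    ∑ x, ∑ x₃, D.lhsSummand x x₃ ≤ Real.exp s * ∑ x, ∑ x₃, D.rhsSummand x x₃ := by
  rw [Finset.mul_sum]
  refine Finset.sum_le_sum fun x _ => ?_
  rw [Finset.mul_sum]
  exact Finset.sum_le_sum fun x₃ _ =>
    lhsSummand_le_exp_mul_rhsSummand D x x₃ hE₀ hnormB hnormB' (hδB x) (hδB' x) (hdBΓ x x₃) (hdBΓ' x x₃)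
      (hgeom x x₃)

/-! ## §4 (Σ). The lattice sums `c₀(δ₁)`, `c₁(δ₁)` of (4.22): *"Summing over x, x₃ we get finally"* -/

/-- **`c₀(δ₁)`**: for every finite set `S` of sites (the points of `□̃⁴ ∩ T₁^{(j)}`, p. 285), every `x₀` and every rate
`a > 0`, `Σ_{x∈S} e^{−a|x − x₀|₁} ≤ K₁(d, a) = Σ_{z∈ℤᵈ} e^{−a|z|₁}` — uniformly in `S` (hence in `N = (Lʲη)⁻¹`).
[cite: Balaban1987RG1, (4.22) p.286] -/
theorem sum_exp_neg_l1_sub_le (S : Finset (Pt d)) (x₀ : Pt d) {a : ℝ} (ha : 0 < a) :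
    ∑ x ∈ S, Real.exp (-(a * l1 (x - x₀))) ≤ K₁ d a := by
  have hs := summable_exp_neg_l1 ha d
  have h2 : ∑ x ∈ S, Real.exp (-(a * l1 (x - x₀))) =
      ∑ w ∈ S.image (fun x => x - x₀), Real.exp (-a * l1 w) := by
    rw [Finset.sum_image (fun p _ q _ h => sub_left_injective h)]
    exact Finset.sum_congr rfl fun x _ => by rw [neg_mul]
  rw [h2]
  exact hs.sum_le_tsum _ fun w _ => (Real.exp_pos _).le

/-- **`c₁(δ₁)`**: for every finite set `S` of sites, every `x` and every rate `a > 0`,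
`Σ_{x₃∈S} e^{−a|x₃ − x|₁}|x₃ − x|₁ ≤ (2/a)·K₁(d, a/2)` (`te^{−at} = e^{−(a/2)t}·(te^{−(a/2)t}) ≤ (2/a)e^{−(a/2)t}`, r20's
`sameBlock_product_le`) — uniformly in `S`. [cite: Balaban1987RG1, (4.22) p.286] -/
theorem sum_exp_neg_l1_mul_le (S : Finset (Pt d)) (x : Pt d) {a : ℝ} (ha : 0 < a) :
    ∑ x₃ ∈ S, Real.exp (-(a * l1 (x₃ - x))) * l1 (x₃ - x) ≤ 2 / a * K₁ d (a / 2) := by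
  have hpt : ∀ x₃ : Pt d, Real.exp (-(a * l1 (x₃ - x))) * l1 (x₃ - x) ≤
      2 / a * Real.exp (-(a / 2 * l1 (x₃ - x))) := by
    intro x₃
    have h := sameBlock_product_le (half_pos ha) (l1 (x₃ - x))
    have he : Real.exp (-(a * l1 (x₃ - x))) =
        Real.exp (-(a / 2 * l1 (x₃ - x))) * Real.exp (-(a / 2 * l1 (x₃ - x))) := by
      rw [← Real.exp_add]
      ring_nf
    rw [he, mul_assoc]
    calc Real.exp (-(a / 2 * l1 (x₃ - x))) * (Real.exp (-(a / 2 * l1 (x₃ - x))) * l1 (x₃ - x))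
        ≤ Real.exp (-(a / 2 * l1 (x₃ - x))) * (a / 2)⁻¹ := mul_le_mul_of_nonneg_left h (Real.exp_pos _).le
      _ = 2 / a * Real.exp (-(a / 2 * l1 (x₃ - x))) := by rw [inv_div]; ring
  calc ∑ x₃ ∈ S, Real.exp (-(a * l1 (x₃ - x))) * l1 (x₃ - x)
      ≤ ∑ x₃ ∈ S, 2 / a * Real.exp (-(a / 2 * l1 (x₃ - x))) := Finset.sum_le_sum fun x₃ _ => hpt x₃
    _ = 2 / a * ∑ x₃ ∈ S, Real.exp (-(a / 2 * l1 (x₃ - x))) := by rw [Finset.mul_sum]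
    _ ≤ 2 / a * K₁ d (a / 2) :=
        mul_le_mul_of_nonneg_left (sum_exp_neg_l1_sub_le S x (half_pos ha)) (by positivity)

/-! ## §5 (E). The different-blocks case of the second sum of (4.21) END TO END on the site lattice -/

/-- **The left member of the p. 286 display SUMMED, in the currency of (4.22)** — sizes, geometry and lattice sums all
discharged.  On the site lattice (cubes of side `M ≥ 1`, `X` a localization domain of the window `B`, `x₀` a site of a
cube of `X`, `S` any finite set of sites carrying the sums over `x, x₃`), for r20's point data `D : PointData286 ↥S` WHOSE
POINT FUNCTIONS ARE THE LATTICE ONES (`dist^{(ξ)}(X, x)` = the sup distance to `X`, `|x − x₀|`, `|x₃ − x|` = the ℓ¹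
lengths, `d_j(X) = treeLen X`), the sizes `|B|, |δB(x)| ≤ α₁Lʲη`, `|(∂B)(Γ_{x,x₃})| ≤ α₁(Lʲη)²|x₃ − x|`, and a rate `δ₁ > 0`
with `2dδ₁ ≤ δ₀`, `3dMδ₁ ≤ κ` (*"δ₁ = O(M⁻¹)"*):
`Σ_{x,x₃} lhsSummand ≤ (8B₃α₁α₂⁻¹)⁴ E₀ c₀(δ₁) c₁(δ₁) e^{−⅓κd_j(X)} (Lʲη)⁵` with the EXPLICIT admissible lattice constants
`c₀(δ₁) = e^{6dMδ₁}K₁(d, δ₁)`, `c₁(δ₁) = (2/δ₁)K₁(d, δ₁/2)`. [cite: Balaban1987RG1, p.286, (4.22)] -/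
theorem sum_lhsSummand_le_lattice (hM : 0 < M) (B : Finset (Pt d)) (X : Dom B) {x₀ : Pt d}
    (hx₀ : cubeOf M x₀ ∈ X.1) (S : Finset (Pt d)) (D : PointData286 S)
    (hdjX : D.djX = treeLen X.1) (hdistX : ∀ x : S, D.distX x = (geomS B M).distD x.1 X)
    (hdist0 : ∀ x : S, D.dist0 x = l1 (x.1 - x₀)) (hlen : ∀ x x₃ : S, D.len x x₃ = l1 (x₃.1 - x.1))
    (hδ₁ : 0 < D.δ₁) (h1 : 2 * d * D.δ₁ ≤ D.δ₀) (h2 : 3 * d * M * D.δ₁ ≤ D.κ)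
    (hE₀ : 0 ≤ D.E₀) (hL : 0 ≤ D.Ljη) (hnormB : 0 ≤ D.normB) (hnormB' : D.normB ≤ D.α₁ * D.Ljη)
    (hδB : ∀ x, 0 ≤ D.δB x) (hδB' : ∀ x, D.δB x ≤ D.α₁ * D.Ljη)
    (hdBΓ : ∀ x x₃, 0 ≤ D.dBΓ x x₃) (hdBΓ' : ∀ x x₃, D.dBΓ x x₃ ≤ D.α₁ * D.Ljη ^ 2 * D.len x x₃) :
    ∑ x, ∑ x₃, D.lhsSummand x x₃ ≤ (8 * D.B₃ * (D.α₁ / D.α₂)) ^ 4 * D.E₀ *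
      (Real.exp (6 * d * M * D.δ₁) * K₁ d D.δ₁) * (2 / D.δ₁ * K₁ d (D.δ₁ / 2)) *
      Real.exp (-(1 / 3 * D.κ * D.djX)) * D.Ljη ^ 5 := by
  -- (G) at every pair of sites of `S`
  have hgeom : ∀ x x₃ : S, D.κ / 3 * D.djX + D.δ₁ * D.dist0 x + D.δ₁ * D.len x x₃ ≤
      D.κ * D.djX + D.δ₀ * D.distX x + D.δ₀ * D.distX x₃ + 6 * d * M * D.δ₁ := by
    intro x x₃
    rw [hdjX, hdistX, hdistX, hdist0, hlen]
    exact geometry286 hM B X hx₀ hδ₁.le h1 h2 x.1 x₃.1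
  have hdisp := sum_lhsSummand_le_exp_mul D hE₀ hnormB hnormB' hδB hδB' hdBΓ hdBΓ' hgeom
  -- (Σ) the two lattice sums
  have hsum0 : ∑ x : S, Real.exp (-(D.δ₁ * D.dist0 x)) ≤ K₁ d D.δ₁ := by
    calc ∑ x : S, Real.exp (-(D.δ₁ * D.dist0 x)) = ∑ x : S, Real.exp (-(D.δ₁ * l1 (x.1 - x₀))) :=
          Finset.sum_congr rfl fun x _ => by rw [hdist0]
      _ = ∑ x ∈ S, Real.exp (-(D.δ₁ * l1 (x - x₀))) :=
          Finset.sum_coe_sort S (fun x => Real.exp (-(D.δ₁ * l1 (x - x₀))))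
      _ ≤ K₁ d D.δ₁ := sum_exp_neg_l1_sub_le S x₀ hδ₁
  have hsum1 : ∀ x : S, ∑ x₃ : S, Real.exp (-(D.δ₁ * D.len x x₃)) * D.len x x₃ ≤ 2 / D.δ₁ * K₁ d (D.δ₁ / 2) := by
    intro x
    calc ∑ x₃ : S, Real.exp (-(D.δ₁ * D.len x x₃)) * D.len x x₃
        = ∑ x₃ : S, Real.exp (-(D.δ₁ * l1 (x₃.1 - x.1))) * l1 (x₃.1 - x.1) :=
          Finset.sum_congr rfl fun x₃ _ => by rw [hlen]
      _ = ∑ x₃ ∈ S, Real.exp (-(D.δ₁ * l1 (x₃ - x.1))) * l1 (x₃ - x.1) :=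
          Finset.sum_coe_sort S (fun x₃ => Real.exp (-(D.δ₁ * l1 (x₃ - x.1))) * l1 (x₃ - x.1))
      _ ≤ 2 / D.δ₁ * K₁ d (D.δ₁ / 2) := sum_exp_neg_l1_mul_le S x.1 hδ₁
  have hc₁ : 0 ≤ 2 / D.δ₁ * K₁ d (D.δ₁ / 2) := mul_nonneg (by positivity) (K₁_nonneg _ _)
  have hrhs := display286_rhs_sum_le D hE₀ hL hc₁ hsum0 hsum1
  calc ∑ x, ∑ x₃, D.lhsSummand x x₃ ≤ Real.exp (6 * d * M * D.δ₁) * ∑ x, ∑ x₃, D.rhsSummand x x₃ := hdisp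
    _ ≤ Real.exp (6 * d * M * D.δ₁) * ((8 * D.B₃ * (D.α₁ / D.α₂)) ^ 4 * D.E₀ * K₁ d D.δ₁ *
          (2 / D.δ₁ * K₁ d (D.δ₁ / 2)) * Real.exp (-(1 / 3 * D.κ * D.djX)) * D.Ljη ^ 5) :=
        mul_le_mul_of_nonneg_left hrhs (Real.exp_pos _).le
    _ = (8 * D.B₃ * (D.α₁ / D.α₂)) ^ 4 * D.E₀ * (Real.exp (6 * d * M * D.δ₁) * K₁ d D.δ₁) *
          (2 / D.δ₁ * K₁ d (D.δ₁ / 2)) * Real.exp (-(1 / 3 * D.κ * D.djX)) * D.Ljη ^ 5 := by ring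

/-- **p. 286, THE DIFFERENT-BLOCKS CASE END TO END**: for every family `termQ x x₃` of terms obeying r20's display shape
`TermEstimate286Printed D termQ` (*"A term corresponding to such a partition can be estimated by Σ_{x,x₃}(…)"* — a
theorem for the actual (4.3) terms, `B12Term286DifferentBlocks.termEstimate286_differentBlocks`), with the point functions
of `D` the lattice ones, the sizes and a rate `δ₁ > 0`, `2dδ₁ ≤ δ₀`, `3dMδ₁ ≤ κ`:
`‖Σ_{x,x₃} termQ x x₃‖ ≤ (8B₃α₁α₂⁻¹)⁴ E₀ c₀(δ₁) c₁(δ₁) e^{−⅓κd_j(X)} (Lʲη)⁵`, `c₀(δ₁) = e^{6dMδ₁}K₁(d, δ₁)`,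
`c₁(δ₁) = (2/δ₁)K₁(d, δ₁/2)` — the per-term input `hs` of r20's `secondSum_le_of_terms` / `kernelBound422_of_terms` ((4.22))
for these terms, with no display hypothesis and no lattice-sum hypothesis. [cite: Balaban1987RG1, p.286, (4.22)] -/
theorem differentBlocks_summed_lattice (hM : 0 < M) (B : Finset (Pt d)) (X : Dom B) {x₀ : Pt d}
    (hx₀ : cubeOf M x₀ ∈ X.1) (S : Finset (Pt d)) {F : Type*} [NormedAddCommGroup F] (D : PointData286 S)
    (termQ : S → S → F) (hT : TermEstimate286Printed D termQ)
    (hdjX : D.djX = treeLen X.1) (hdistX : ∀ x : S, D.distX x = (geomS B M).distD x.1 X)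
    (hdist0 : ∀ x : S, D.dist0 x = l1 (x.1 - x₀)) (hlen : ∀ x x₃ : S, D.len x x₃ = l1 (x₃.1 - x.1))
    (hδ₁ : 0 < D.δ₁) (h1 : 2 * d * D.δ₁ ≤ D.δ₀) (h2 : 3 * d * M * D.δ₁ ≤ D.κ)
    (hE₀ : 0 ≤ D.E₀) (hL : 0 ≤ D.Ljη) (hnormB : 0 ≤ D.normB) (hnormB' : D.normB ≤ D.α₁ * D.Ljη)
    (hδB : ∀ x, 0 ≤ D.δB x) (hδB' : ∀ x, D.δB x ≤ D.α₁ * D.Ljη)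
    (hdBΓ : ∀ x x₃, 0 ≤ D.dBΓ x x₃) (hdBΓ' : ∀ x x₃, D.dBΓ x x₃ ≤ D.α₁ * D.Ljη ^ 2 * D.len x x₃) :
    ‖∑ x, ∑ x₃, termQ x x₃‖ ≤ (8 * D.B₃ * (D.α₁ / D.α₂)) ^ 4 * D.E₀ *
      (Real.exp (6 * d * M * D.δ₁) * K₁ d D.δ₁) * (2 / D.δ₁ * K₁ d (D.δ₁ / 2)) *
      Real.exp (-(1 / 3 * D.κ * D.djX)) * D.Ljη ^ 5 :=
  hT.trans (sum_lhsSummand_le_lattice hM B X hx₀ S D hdjX hdistX hdist0 hlen hδ₁ h1 h2 hE₀ hL hnormB hnormB' hδB hδB'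
    hdBΓ hdBΓ')

/-! ## §6 (v1.1). The display AS PRINTED under the size margin, and `K₁ ≥ 1` -/

/-- **The p. 286 display holds AS PRINTED (non-strict) once the sizes carry the margin `e^{−s/4}`** — i.e. the located factor is
absorbed into the unquantified `O(1)` of the size restriction *"O(1)(α₂ + B₃O(1)Mα₀) < α₁"* of (4.17)/(3.32): if `|B|, |δB(x)| ≤
α′Lʲη`, `|(∂B)(Γ_{x,x₃})| ≤ α′(Lʲη)²|x₃ − x|` with `eˢ·α′⁴ ≤ α₁⁴` (for the example δ₁: `α′ = e^{−1/2}α₁` suffices), and the geometry (G)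
with slack `s`, then `lhsSummand x x₃ ≤ rhsSummand x x₃` with the printed constant `(8B₃α₁α₂⁻¹)⁴`. [cite: Balaban1987RG1, p.286; (4.17) p.285] -/
theorem lhsSummand_le_rhsSummand_of_margin {P : Type*} (D : PointData286 P) {s α' : ℝ} (x x₃ : P)
    (hE₀ : 0 ≤ D.E₀) (hL : 0 ≤ D.Ljη) (hnormB : 0 ≤ D.normB) (hnormB' : D.normB ≤ α' * D.Ljη)
    (hδB : 0 ≤ D.δB x) (hδB' : D.δB x ≤ α' * D.Ljη)
    (hdBΓ : 0 ≤ D.dBΓ x x₃) (hdBΓ' : D.dBΓ x x₃ ≤ α' * D.Ljη ^ 2 * D.len x x₃) (hlen : 0 ≤ D.len x x₃)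
    (hmargin : Real.exp s * α' ^ 4 ≤ D.α₁ ^ 4)
    (hgeom : D.κ / 3 * D.djX + D.δ₁ * D.dist0 x + D.δ₁ * D.len x x₃ ≤
      D.κ * D.djX + D.δ₀ * D.distX x + D.δ₀ * D.distX x₃ + s) :
    D.lhsSummand x x₃ ≤ D.rhsSummand x x₃ := by
  -- the pointwise theorem for the data with `α₁ := α'` (its left summand is the same)
  have h := lhsSummand_le_exp_mul_rhsSummand { D with α₁ := α' } x x₃ hE₀ hnormB hnormB' hδB hδB' hdBΓ hdBΓ' hgeom
  have hl : ({ D with α₁ := α' } : PointData286 P).lhsSummand x x₃ = D.lhsSummand x x₃ := rfl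
  rw [hl] at h
  refine h.trans ?_
  rw [PointData286.rhsSummand_eq, D.rhsSummand_eq]
  have h8 : 0 ≤ (8 * D.B₃ / D.α₂) ^ 4 := Even.pow_nonneg ⟨2, rfl⟩ _
  have hX : 0 ≤ D.E₀ * Real.exp (-(1 / 3 * D.κ * D.djX)) * D.Ljη ^ 5 *
      (Real.exp (-(D.δ₁ * D.dist0 x)) * (Real.exp (-(D.δ₁ * D.len x x₃)) * D.len x x₃)) := by positivity
  calc Real.exp s * ((8 * D.B₃ * (α' / D.α₂)) ^ 4 * D.E₀ * Real.exp (-(1 / 3 * D.κ * D.djX)) * D.Ljη ^ 5 *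
        (Real.exp (-(D.δ₁ * D.dist0 x)) * (Real.exp (-(D.δ₁ * D.len x x₃)) * D.len x x₃)))
      = (Real.exp s * α' ^ 4) * ((8 * D.B₃ / D.α₂) ^ 4 * (D.E₀ * Real.exp (-(1 / 3 * D.κ * D.djX)) * D.Ljη ^ 5 *
        (Real.exp (-(D.δ₁ * D.dist0 x)) * (Real.exp (-(D.δ₁ * D.len x x₃)) * D.len x x₃)))) := by ring
    _ ≤ D.α₁ ^ 4 * ((8 * D.B₃ / D.α₂) ^ 4 * (D.E₀ * Real.exp (-(1 / 3 * D.κ * D.djX)) * D.Ljη ^ 5 *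
        (Real.exp (-(D.δ₁ * D.dist0 x)) * (Real.exp (-(D.δ₁ * D.len x x₃)) * D.len x x₃)))) :=
        mul_le_mul_of_nonneg_right hmargin (mul_nonneg h8 hX)
    _ = (8 * D.B₃ * (D.α₁ / D.α₂)) ^ 4 * D.E₀ * Real.exp (-(1 / 3 * D.κ * D.djX)) * D.Ljη ^ 5 *
        (Real.exp (-(D.δ₁ * D.dist0 x)) * (Real.exp (-(D.δ₁ * D.len x x₃)) * D.len x x₃)) := by ring

/-- **The summed display AS PRINTED (non-strict) under the size margin**: `Σ_{x,x₃} lhsSummand ≤ Σ_{x,x₃} rhsSummand` — the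
inequality r20's `Display286Printed D` asserts with `<` (its consumers `differentBlocks_summed_le`, `kernelBound422_actual` use
only `≤`). [cite: Balaban1987RG1, p.286] -/
theorem sum_lhsSummand_le_sum_rhsSummand_of_margin {P : Type*} [Fintype P] (D : PointData286 P) {s α' : ℝ}
    (hE₀ : 0 ≤ D.E₀) (hL : 0 ≤ D.Ljη) (hnormB : 0 ≤ D.normB) (hnormB' : D.normB ≤ α' * D.Ljη)
    (hδB : ∀ x, 0 ≤ D.δB x) (hδB' : ∀ x, D.δB x ≤ α' * D.Ljη)
    (hdBΓ : ∀ x x₃, 0 ≤ D.dBΓ x x₃) (hdBΓ' : ∀ x x₃, D.dBΓ x x₃ ≤ α' * D.Ljη ^ 2 * D.len x x₃)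
    (hlen : ∀ x x₃, 0 ≤ D.len x x₃) (hmargin : Real.exp s * α' ^ 4 ≤ D.α₁ ^ 4)
    (hgeom : ∀ x x₃, D.κ / 3 * D.djX + D.δ₁ * D.dist0 x + D.δ₁ * D.len x x₃ ≤
      D.κ * D.djX + D.δ₀ * D.distX x + D.δ₀ * D.distX x₃ + s) :
    ∑ x, ∑ x₃, D.lhsSummand x x₃ ≤ ∑ x, ∑ x₃, D.rhsSummand x x₃ :=
  Finset.sum_le_sum fun x _ => Finset.sum_le_sum fun x₃ _ =>
    lhsSummand_le_rhsSummand_of_margin D x x₃ hE₀ hL hnormB hnormB' (hδB x) (hδB' x) (hdBΓ x x₃) (hdBΓ' x x₃)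
      (hlen x x₃) hmargin (hgeom x x₃)

/-- `K₁(d, a) ≥ 1` (the `z = 0` term), so that the bookkeeping `1 ≤ c₀(δ₁)c₁(δ₁)` of (4.22) holds for `δ₁ ≤ 2`.
[cite: Balaban1987RG1, (4.22) p.286] -/
theorem one_le_K₁ (d : ℕ) {a : ℝ} (ha : 0 < a) : 1 ≤ K₁ d a := by
  have hs := summable_exp_neg_l1 ha d
  have h0 : Real.exp (-a * l1 (0 : Pt d)) = 1 := by simp [l1]
  calc (1 : ℝ) = Real.exp (-a * l1 (0 : Pt d)) := h0.symm
    _ ≤ K₁ d a := hs.le_tsum 0 fun z _ => (Real.exp_pos _).le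

/-! ## §7 (v1.1). The different-blocks family and (4.22) for the ACTUAL expansion, the display derived -/

/-- **p. 286 → (4.22): THE DIFFERENT-BLOCKS FAMILY FROM THE PRINTED INPUTS ONLY** (v1.1; r20 g11's
`termEstimate286_differentBlocks` composed with `differentBlocks_summed_lattice`).  On the site lattice (cubes of side
`M ≥ 1`, `X` a localization domain of the window `B`, `x₀` *"a fixed point in X"*, `S` the finite set of sites carrying the sums
over `x, x₃`, r20's point data `D : PointData286 ↥S` with the lattice point functions), for the ACTUAL (4.3) terms of a partition
`c` of the four arguments `δB(x), B, B, (∂B)(Γ_{x,x₃})` of the second sum of (4.21) with `x, x₃` *"connected with different sets"*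
(`c.index 0 ≠ c.index 3`): the outer function `𝐄 = 𝐀 ↦ 𝐄^{(j)}(X, exp iξ𝐀)` analytic on an open `U ⊇ {‖𝐀‖ < α₂}` ((4.4)) with
`‖𝐄‖ ≤ E₀e^{−κd_j(X)}` there ((1.18)); `H = 𝐇_j(□₀, ·)` analytic on an open `U_W ⊇ {‖·‖ < a}` with `‖H‖ ≤ S_H` ([15] Prop. 9) and
the (190)-shape first-order localisation bounds for the `x`- and `x₃`-localised arguments (p. 282); the sizes `‖B_0‖ ≤ |δB(x)| ≤
α₁Lʲη`, `‖B_1‖, ‖B_2‖ ≤ |B| ≤ α₁Lʲη`, `‖B_3‖ ≤ |(∂B)(Γ_{x,x₃})| ≤ α₁(Lʲη)²|x₃ − x|`; `B₃ ≥ max{S_H, K}·max{1, 8/a}⁴`, `8B₃ ≥ α₂`;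
a rate `δ₁ > 0` with `2dδ₁ ≤ δ₀`, `3dMδ₁ ≤ κ`.  THEN
`‖Σ_{x,x₃} D^{|c|}𝐄(0)[⟨δ^{n(p)}𝐇(0), ⊗_{i∈N(p)}B_i(x,x₃)⟩_p]‖ ≤ (8B₃α₁α₂⁻¹)⁴ E₀ c₀(δ₁) c₁(δ₁) e^{−⅓κd_j(X)} (Lʲη)⁵`,
`c₀(δ₁) = e^{6dMδ₁}K₁(d, δ₁)`, `c₁(δ₁) = (2/δ₁)K₁(d, δ₁/2)` — the per-term input `hs` of r20's `secondSum_le_of_terms` /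
`kernelBound422_of_terms` for every different-blocks term, no display / lattice-sum / block hypothesis.
[cite: Balaban1987RG1, p.286, (4.22); (4.3)–(4.5) pp.281–282; (1.18) p.263] -/
theorem secondSum_differentBlocks_actual (hM : 0 < M) (B : Finset (Pt d)) (X : Dom B) {x₀ : Pt d}
    (hx₀ : cubeOf M x₀ ∈ X.1) (S : Finset (Pt d)) (D : PointData286 S)
    (hdjX : D.djX = treeLen X.1) (hdistX : ∀ x : S, D.distX x = (geomS B M).distD x.1 X)
    (hdist0 : ∀ x : S, D.dist0 x = l1 (x.1 - x₀)) (hlen : ∀ x x₃ : S, D.len x x₃ = l1 (x₃.1 - x.1))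
    (hδ₁ : 0 < D.δ₁) (h1 : 2 * d * D.δ₁ ≤ D.δ₀) (h2 : 3 * d * M * D.δ₁ ≤ D.κ) (hE₀ : 0 ≤ D.E₀) (hL : 0 ≤ D.Ljη)
    {W : Type*} [NormedAddCommGroup W] [NormedSpace ℂ W]
    {E : Type*} [NormedAddCommGroup E] [NormedSpace ℂ E] [CompleteSpace E]
    {F : Type*} [NormedAddCommGroup F] [NormedSpace ℂ F] [CompleteSpace F]
    {U : Set E} (hU : IsOpen U) (hα : 0 < D.α₂) (hαB : D.α₂ ≤ 8 * D.B₃) (hball : ball (0 : E) D.α₂ ⊆ U)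
    {f : E → F} (hf : AnalyticOnNhd ℂ f U)
    (hS : ∀ y ∈ ball (0 : E) D.α₂, ‖f y‖ ≤ D.E₀ * Real.exp (-(D.κ * D.djX)))
    {UW : Set W} (hUW : IsOpen UW) {a SH K : ℝ} (ha : 0 < a) (hballW : ball (0 : W) a ⊆ UW)
    {H : W → E} (hH : AnalyticOnNhd ℂ H UW) (hSH : ∀ y ∈ ball (0 : W) a, ‖H y‖ ≤ SH) (hK : 0 ≤ K)
    (Bf : S → S → Fin 4 → W) (hB0 : ∀ x x₃, ‖Bf x x₃ 0‖ ≤ D.δB x) (hB1 : ∀ x x₃, ‖Bf x x₃ 1‖ ≤ D.normB)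
    (hB2 : ∀ x x₃, ‖Bf x x₃ 2‖ ≤ D.normB) (hB3 : ∀ x x₃, ‖Bf x x₃ 3‖ ≤ D.dBΓ x x₃)
    (hlocx : ∀ x x₃, ∀ y ∈ ball (0 : W) a,
      ‖fderiv ℂ H y (Bf x x₃ 0)‖ ≤ Real.exp (-(D.δ₀ * D.distX x)) * (K * ‖Bf x x₃ 0‖))
    (hlocx₃ : ∀ x x₃, ∀ y ∈ ball (0 : W) a,
      ‖fderiv ℂ H y (Bf x x₃ 3)‖ ≤ Real.exp (-(D.δ₀ * D.distX x₃)) * (K * ‖Bf x x₃ 3‖))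
    (hB₃ : max SH K * (max 1 (2 * (4 : ℝ) / a)) ^ 4 ≤ D.B₃)
    (hnormB : 0 ≤ D.normB) (hnormB' : D.normB ≤ D.α₁ * D.Ljη) (hδB' : ∀ x, D.δB x ≤ D.α₁ * D.Ljη)
    (hdBΓ' : ∀ x x₃, D.dBΓ x x₃ ≤ D.α₁ * D.Ljη ^ 2 * D.len x x₃)
    (c : OrderedFinpartition 4) (hc : c.index 0 ≠ c.index 3) :
    ‖∑ x, ∑ x₃, iteratedFDeriv ℂ c.length f 0 (blockIns (𝕜 := ℂ) H 0 (Bf x x₃) c)‖ ≤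
      (8 * D.B₃ * (D.α₁ / D.α₂)) ^ 4 * D.E₀ *
      (Real.exp (6 * d * M * D.δ₁) * K₁ d D.δ₁) * (2 / D.δ₁ * K₁ d (D.δ₁ / 2)) *
      Real.exp (-(1 / 3 * D.κ * D.djX)) * D.Ljη ^ 5 := by
  have hδ₀ : 0 ≤ D.δ₀ := le_trans (by positivity) h1
  have hδ : ∀ x : S, 0 ≤ D.δ₀ * D.distX x := fun x => by
    rw [hdistX]
    exact mul_nonneg hδ₀ ((geomS B M).distD_nonneg x.1 X)
  have hT := termEstimate286_differentBlocks D hU hα hαB hball hf hS hUW ha hballW hH hSH hK Bf hB0 hB1 hB2 hB3 hδ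
    hlocx hlocx₃ hB₃ c hc
  exact differentBlocks_summed_lattice hM B X hx₀ S D _ hT hdjX hdistX hdist0 hlen hδ₁ h1 h2 hE₀ hL hnormB hnormB'
    (fun x => (norm_nonneg _).trans (hB0 x x)) hδB' (fun x x₃ => (norm_nonneg _).trans (hB3 x x₃)) hdBΓ'

/-- **(4.22) FOR THE ACTUAL SECOND SUM OF (4.21), THE p. 286 DISPLAY DERIVED** (r20 g11's `kernelBound422_actual` with its
by-reference hypotheses `hD : Display286Printed D`, `hsum0`, `hsum1` REPLACED by the sizes + the site-lattice geometry + the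
explicit lattice constants).  With `lhs2 := ‖Σ_{x,x₃} D⁴(𝐄∘𝐇)(0)[δB(x), B, B, (∂B)(Γ_{x,x₃})]‖` (the second sum of (4.21) written
through (4.2)–(4.3), `B12Term286DifferentBlocks.secondSum_expansion`), the printed inputs of `secondSum_differentBlocks_actual`,
`𝐇(0) = 0` ([15] Prop. 9), the SAME-BLOCK terms by reference (`hsame`: p. 286 first case = [15] Sect. G tree decay for several
localized arguments in one block, cell GAPS G-B11-G2a — stated as the same summed per-term bound with the explicit constants), and
the bookkeeping `E₀ ≤ 1`, `δ₁ ≤ 2` (so that `1 ≤ c₀(δ₁)c₁(δ₁)`; how `E₀` and the `≤ 4⁴` term count enter the printed constant is not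
displayed — r20's `kernelBound422_of_terms`): `KernelBound422Printed ⟨lhs2, B₃, α₁, α₂, c₀(δ₁), c₁(δ₁), κ, d_j(X), Lʲη⟩`,
`c₀(δ₁) = e^{6dMδ₁}K₁(d, δ₁)`, `c₁(δ₁) = (2/δ₁)K₁(d, δ₁/2)`. [cite: Balaban1987RG1, (4.21)–(4.22) pp.285–286] -/
theorem kernelBound422_actual_lattice (hM : 0 < M) (B : Finset (Pt d)) (X : Dom B) {x₀ : Pt d}
    (hx₀ : cubeOf M x₀ ∈ X.1) (S : Finset (Pt d)) (D : PointData286 S)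
    (hdjX : D.djX = treeLen X.1) (hdistX : ∀ x : S, D.distX x = (geomS B M).distD x.1 X)
    (hdist0 : ∀ x : S, D.dist0 x = l1 (x.1 - x₀)) (hlen : ∀ x x₃ : S, D.len x x₃ = l1 (x₃.1 - x.1))
    (hδ₁ : 0 < D.δ₁) (hδ₁2 : D.δ₁ ≤ 2) (h1 : 2 * d * D.δ₁ ≤ D.δ₀) (h2 : 3 * d * M * D.δ₁ ≤ D.κ)
    (hE₁ : D.E₀ ≤ 1) (hL : 0 ≤ D.Ljη)
    {W : Type*} [NormedAddCommGroup W] [NormedSpace ℂ W]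
    {E : Type*} [NormedAddCommGroup E] [NormedSpace ℂ E] [CompleteSpace E]
    {F : Type*} [NormedAddCommGroup F] [NormedSpace ℂ F] [CompleteSpace F]
    {U : Set E} (hU : IsOpen U) (hα : 0 < D.α₂) (hαB : D.α₂ ≤ 8 * D.B₃) (hball : ball (0 : E) D.α₂ ⊆ U)
    {f : E → F} (hf : AnalyticOnNhd ℂ f U)
    (hS : ∀ y ∈ ball (0 : E) D.α₂, ‖f y‖ ≤ D.E₀ * Real.exp (-(D.κ * D.djX)))
    {UW : Set W} (hUW : IsOpen UW) {a SH K : ℝ} (ha : 0 < a) (hballW : ball (0 : W) a ⊆ UW)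
    {H : W → E} (hH : AnalyticOnNhd ℂ H UW) (hSH : ∀ y ∈ ball (0 : W) a, ‖H y‖ ≤ SH) (hH0 : H 0 = 0) (hK : 0 ≤ K)
    (Bf : S → S → Fin 4 → W) (hB0 : ∀ x x₃, ‖Bf x x₃ 0‖ ≤ D.δB x) (hB1 : ∀ x x₃, ‖Bf x x₃ 1‖ ≤ D.normB)
    (hB2 : ∀ x x₃, ‖Bf x x₃ 2‖ ≤ D.normB) (hB3 : ∀ x x₃, ‖Bf x x₃ 3‖ ≤ D.dBΓ x x₃)
    (hlocx : ∀ x x₃, ∀ y ∈ ball (0 : W) a,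
      ‖fderiv ℂ H y (Bf x x₃ 0)‖ ≤ Real.exp (-(D.δ₀ * D.distX x)) * (K * ‖Bf x x₃ 0‖))
    (hlocx₃ : ∀ x x₃, ∀ y ∈ ball (0 : W) a,
      ‖fderiv ℂ H y (Bf x x₃ 3)‖ ≤ Real.exp (-(D.δ₀ * D.distX x₃)) * (K * ‖Bf x x₃ 3‖))
    (hB₃ : max SH K * (max 1 (2 * (4 : ℝ) / a)) ^ 4 ≤ D.B₃)
    (hnormB : 0 ≤ D.normB) (hnormB' : D.normB ≤ D.α₁ * D.Ljη) (hδB' : ∀ x, D.δB x ≤ D.α₁ * D.Ljη)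
    (hdBΓ' : ∀ x x₃, D.dBΓ x x₃ ≤ D.α₁ * D.Ljη ^ 2 * D.len x x₃)
    (hsame : ∀ c : OrderedFinpartition 4, c.index 0 = c.index 3 →
      ‖∑ x, ∑ x₃, iteratedFDeriv ℂ c.length f 0 (blockIns (𝕜 := ℂ) H 0 (Bf x x₃) c)‖ ≤
        (8 * D.B₃ * (D.α₁ / D.α₂)) ^ 4 * D.E₀ * (Real.exp (6 * d * M * D.δ₁) * K₁ d D.δ₁) *
          (2 / D.δ₁ * K₁ d (D.δ₁ / 2)) * Real.exp (-(1 / 3 * D.κ * D.djX)) * D.Ljη ^ 5) :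
    KernelBound422Printed
      ⟨‖∑ x, ∑ x₃, iteratedFDeriv ℂ 4 (f ∘ H) 0 (Bf x x₃)‖, D.B₃, D.α₁, D.α₂,
        Real.exp (6 * d * M * D.δ₁) * K₁ d D.δ₁, 2 / D.δ₁ * K₁ d (D.δ₁ / 2), D.κ, D.djX, D.Ljη⟩ := by
  have hE₀ : 0 ≤ D.E₀ := by
    have h1 := hS 0 (mem_ball_self hα)
    have h2 : 0 ≤ D.E₀ * Real.exp (-(D.κ * D.djX)) := (norm_nonneg _).trans h1
    by_contra h
    exact absurd h2 (not_le.2 (mul_neg_of_neg_of_pos (not_le.1 h) (Real.exp_pos _)))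
  have hcount : (Finset.univ : Finset (OrderedFinpartition 4)).card ≤ 4 ^ 4 := by
    rw [Finset.card_univ]
    exact card_orderedFinpartition_le_pow 4
  -- the bookkeeping `1 ≤ c₀(δ₁)c₁(δ₁)` for `δ₁ ≤ 2`
  have hK0 : 1 ≤ K₁ d D.δ₁ := one_le_K₁ d hδ₁
  have hK2 : 1 ≤ K₁ d (D.δ₁ / 2) := one_le_K₁ d (half_pos hδ₁)
  have hexp1 : 1 ≤ Real.exp (6 * d * M * D.δ₁) := Real.one_le_exp (by positivity)
  have hcc : 1 ≤ Real.exp (6 * d * M * D.δ₁) * K₁ d D.δ₁ * (2 / D.δ₁ * K₁ d (D.δ₁ / 2)) := by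
    have h21 : 1 ≤ 2 / D.δ₁ := by rw [le_div_iff₀ hδ₁]; linarith
    calc (1 : ℝ) = 1 * 1 * (1 * 1) := by ring
      _ ≤ Real.exp (6 * d * M * D.δ₁) * K₁ d D.δ₁ * (2 / D.δ₁ * K₁ d (D.δ₁ / 2)) :=
          mul_le_mul (mul_le_mul hexp1 hK0 zero_le_one (by positivity)) (mul_le_mul h21 hK2 zero_le_one (by positivity))
            (by positivity) (by positivity)
  refine kernelBound422_of_terms _ Finset.univ hcount
    (fun c => ‖∑ x, ∑ x₃, iteratedFDeriv ℂ c.length f 0 (blockIns (𝕜 := ℂ) H 0 (Bf x x₃) c)‖)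
    hE₀ hE₁ hcc hL ?_ ?_
  · -- (4.3) + triangle inequality over the partitions
    show ‖∑ x, ∑ x₃, iteratedFDeriv ℂ 4 (f ∘ H) 0 (Bf x x₃)‖ ≤ _
    rw [secondSum_expansion hU hα hball hf hUW ha hballW hH hH0 Bf]
    exact norm_sum_le _ _
  · intro c _
    by_cases hc : c.index 0 = c.index 3
    · exact hsame c hc
    · have h := secondSum_differentBlocks_actual hM B X hx₀ S D hdjX hdistX hdist0 hlen hδ₁ h1 h2 hE₀ hL hU hα hαB
        hball hf hS hUW ha hballW hH hSH hK Bf hB0 hB1 hB2 hB3 hlocx hlocx₃ hB₃ hnormB hnormB' hδB' hdBΓ' c hc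
      calc _ ≤ _ := h
        _ = _ := by ring

/-! ## §8 (v1.2). The same-block family on the site lattice (p05 g9's half-rate route) and (4.22) CLOSED

p. 286, the first case: *"In the first the points x, x₃ are connected with the same set N(p) in (4.3). Then the exponential
factor, with a length of a shortest tree graph in the exponent, yields the factor exp(−δ₀|x₃ − x|), and the product of it with
|x₃ − x| is bounded by δ₀⁻¹."*  p05 g9's `B12Term286SameBlock` (p309645) routes the same-block terms WITHOUT that [15] Sect. G
tree factor: the block `N(p) ∋ 0, 3` holds BOTH localised arguments, so the p. 282 first-order sentence applies to it twice and
its weight is `≤ min{e^{−δ₀dist(X,x)}, e^{−δ₀dist(X,x₃)}} ≤ e^{−(δ₀/2)dist(X,x)}e^{−(δ₀/2)dist(X,x₃)}` — a same-block term obeys the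
printed term estimate FOR THE DATA AT RATE `δ₀/2` (`termEstimate286_sameBlock`: `TermEstimate286Printed {D with δ₀ := δ₀/2}`).
Our right-member / lattice derivation (§§2–5) is uniform in the data, so it applies verbatim at rate `δ₀/2`, the first geometric
restriction becoming `2dδ₁ ≤ δ₀/2` (still *"δ₁ = O(M⁻¹)"*). -/

/-- **THE SAME-BLOCK FAMILY OF (4.22), SUMMED ON THE SITE LATTICE, FROM THE PRINTED INPUTS ONLY**: for a partition `c` of the
four arguments with `δB(x)` and `(∂B)(Γ_{x,x₃})` in the SAME block (`c.index 0 = c.index 3`), under exactly the printed inputs of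
`secondSum_differentBlocks_actual` ((4.4) + (1.18); [15] Prop. 9; the two (190)-shape first-order localisation bounds; the
sizes; the lattice geometry with `x₀ ∈ X`) and the restrictions `4dδ₁ ≤ δ₀`, `3dMδ₁ ≤ κ`:
`‖Σ_{x,x₃} D^{|c|}𝐄(0)[v(c; x, x₃)]‖ ≤ (8B₃α₁α₂⁻¹)⁴ E₀ c₀(δ₁) c₁(δ₁) e^{−⅓κd_j(X)} (Lʲη)⁵` with `c₀ = e^{6dMδ₁}K₁(d, δ₁)`,
`c₁ = (2/δ₁)K₁(d, δ₁/2)` — p05 g9's `termEstimate286_sameBlock` (half-rate printed term estimate) composed with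
`differentBlocks_summed_lattice` at the data `{D with δ₀ := δ₀/2}`.  This is r20's by-reference hypothesis `hsame` of
`kernelBound422_actual` / our `kernelBound422_actual_lattice`, PROVED.  (Print's own route — the tree factor `e^{−δ₀|x₃ − x|}`
of [15] Sect. G, cell GAPS G-B11-G2a — is not used and not claimed.) [cite: Balaban1987RG1, p.286, (4.22)] -/
theorem secondSum_sameBlock_actual (hM : 0 < M) (B : Finset (Pt d)) (X : Dom B) {x₀ : Pt d}
    (hx₀ : cubeOf M x₀ ∈ X.1) (S : Finset (Pt d)) (D : PointData286 S)
    (hdjX : D.djX = treeLen X.1) (hdistX : ∀ x : S, D.distX x = (geomS B M).distD x.1 X)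
    (hdist0 : ∀ x : S, D.dist0 x = l1 (x.1 - x₀)) (hlen : ∀ x x₃ : S, D.len x x₃ = l1 (x₃.1 - x.1))
    (hδ₁ : 0 < D.δ₁) (h1 : 4 * d * D.δ₁ ≤ D.δ₀) (h2 : 3 * d * M * D.δ₁ ≤ D.κ) (hE₀ : 0 ≤ D.E₀) (hL : 0 ≤ D.Ljη)
    {W : Type*} [NormedAddCommGroup W] [NormedSpace ℂ W]
    {E : Type*} [NormedAddCommGroup E] [NormedSpace ℂ E] [CompleteSpace E]
    {F : Type*} [NormedAddCommGroup F] [NormedSpace ℂ F] [CompleteSpace F]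
    {U : Set E} (hU : IsOpen U) (hα : 0 < D.α₂) (hαB : D.α₂ ≤ 8 * D.B₃) (hball : ball (0 : E) D.α₂ ⊆ U)
    {f : E → F} (hf : AnalyticOnNhd ℂ f U)
    (hS : ∀ y ∈ ball (0 : E) D.α₂, ‖f y‖ ≤ D.E₀ * Real.exp (-(D.κ * D.djX)))
    {UW : Set W} (hUW : IsOpen UW) {a SH K : ℝ} (ha : 0 < a) (hballW : ball (0 : W) a ⊆ UW)
    {H : W → E} (hH : AnalyticOnNhd ℂ H UW) (hSH : ∀ y ∈ ball (0 : W) a, ‖H y‖ ≤ SH) (hK : 0 ≤ K)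
    (Bf : S → S → Fin 4 → W) (hB0 : ∀ x x₃, ‖Bf x x₃ 0‖ ≤ D.δB x) (hB1 : ∀ x x₃, ‖Bf x x₃ 1‖ ≤ D.normB)
    (hB2 : ∀ x x₃, ‖Bf x x₃ 2‖ ≤ D.normB) (hB3 : ∀ x x₃, ‖Bf x x₃ 3‖ ≤ D.dBΓ x x₃)
    (hlocx : ∀ x x₃, ∀ y ∈ ball (0 : W) a,
      ‖fderiv ℂ H y (Bf x x₃ 0)‖ ≤ Real.exp (-(D.δ₀ * D.distX x)) * (K * ‖Bf x x₃ 0‖))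
    (hlocx₃ : ∀ x x₃, ∀ y ∈ ball (0 : W) a,
      ‖fderiv ℂ H y (Bf x x₃ 3)‖ ≤ Real.exp (-(D.δ₀ * D.distX x₃)) * (K * ‖Bf x x₃ 3‖))
    (hB₃ : max SH K * (max 1 (2 * (4 : ℝ) / a)) ^ 4 ≤ D.B₃)
    (hnormB : 0 ≤ D.normB) (hnormB' : D.normB ≤ D.α₁ * D.Ljη) (hδB' : ∀ x, D.δB x ≤ D.α₁ * D.Ljη)
    (hdBΓ' : ∀ x x₃, D.dBΓ x x₃ ≤ D.α₁ * D.Ljη ^ 2 * D.len x x₃)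
    (c : OrderedFinpartition 4) (hc : c.index 0 = c.index 3) :
    ‖∑ x, ∑ x₃, iteratedFDeriv ℂ c.length f 0 (blockIns (𝕜 := ℂ) H 0 (Bf x x₃) c)‖ ≤
      (8 * D.B₃ * (D.α₁ / D.α₂)) ^ 4 * D.E₀ *
      (Real.exp (6 * d * M * D.δ₁) * K₁ d D.δ₁) * (2 / D.δ₁ * K₁ d (D.δ₁ / 2)) *
      Real.exp (-(1 / 3 * D.κ * D.djX)) * D.Ljη ^ 5 := by
  have hδ₀ : 0 ≤ D.δ₀ := le_trans (by positivity) h1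
  have hδ : ∀ x : S, 0 ≤ D.δ₀ * D.distX x := fun x => by
    rw [hdistX]
    exact mul_nonneg hδ₀ ((geomS B M).distD_nonneg x.1 X)
  -- p05 g9: the same-block term obeys the printed term estimate for the data at rate `δ₀/2`
  have hT := termEstimate286_sameBlock D hU hα hαB hball hf hS hUW ha hballW hH hSH hK Bf hB0 hB1 hB2 hB3 hδ
    hlocx hlocx₃ hB₃ c hc
  -- our lattice derivation at the data `{D with δ₀ := δ₀/2}` (first restriction: `2dδ₁ ≤ δ₀/2`)
  have h1' : 2 * (d : ℝ) * D.δ₁ ≤ D.δ₀ / 2 := by linarith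
  exact differentBlocks_summed_lattice hM B X hx₀ S ({ D with δ₀ := D.δ₀ / 2 } : PointData286 S) _ hT hdjX hdistX
    hdist0 hlen hδ₁ h1' h2 hE₀ hL hnormB hnormB' (fun x => (norm_nonneg _).trans (hB0 x x)) hδB'
    (fun x x₃ => (norm_nonneg _).trans (hB3 x x₃)) hdBΓ'

/-- **(4.22) FOR THE ACTUAL SECOND SUM OF (4.21) — CLOSED: BOTH partition families, the p. 286 display's right member and the
lattice sums ALL DERIVED** (`kernelBound422_actual_lattice` with its last by-reference hypothesis `hsame` discharged by
`secondSum_sameBlock_actual`).  With `lhs2 := ‖Σ_{x,x₃} D⁴(𝐄∘𝐇)(0)[δB(x), B, B, (∂B)(Γ_{x,x₃})]‖` (the second sum of (4.21)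
written through (4.2)–(4.3)), the hypotheses are exactly the PRINTED INPUTS named in the text: (4.4) + (1.18) (the outer function
`𝐄 = 𝐀 ↦ 𝐄^{(j)}(X, exp iξ𝐀)` analytic on `{‖𝐀‖ < α₂}` with sup `E₀e^{−κd_j(X)}`); [15] Prop. 9 (`𝐇 = 𝐇_j(□₀, ·)` analytic on
`{‖·‖ < a}` with sup `S_H`, `𝐇(0) = 0`); the p. 282 / (190)-shape first-order localisation bounds for `δB(x)` and `(∂B)(Γ_{x,x₃})`;
the sizes `|B|, |δB(x)| ≤ α₁Lʲη`, `|(∂B)(Γ_{x,x₃})| ≤ α₁(Lʲη)²|x₃ − x|` ((4.17), p. 286); `B₃ ≥ max{S_H, K}·max{1, 8/a}⁴`,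
`8B₃ ≥ α₂`; the lattice geometry (`dist^{(ξ)}(X, ·)`, `|x − x₀|`, `|x₃ − x|`, `d_j(X)`, *"x₀ is a fixed point in X"*); *"δ₁ =
O(M⁻¹)"* as `0 < δ₁ ≤ 2`, `4dδ₁ ≤ δ₀`, `3dMδ₁ ≤ κ`; and the bookkeeping `E₀ ≤ 1` of r20's `kernelBound422_of_terms`.  Conclusion:
r20's decl of record `KernelBound422Printed ⟨lhs2, B₃, α₁, α₂, c₀(δ₁), c₁(δ₁), κ, d_j(X), Lʲη⟩` with the explicit admissible
lattice constants `c₀(δ₁) = e^{6dMδ₁}K₁(d, δ₁)`, `c₁(δ₁) = (2/δ₁)K₁(d, δ₁/2)`.  No display hypothesis, no lattice-sum hypothesis,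
no per-partition hypothesis remains.  HONEST: the same-block family enters by p05 g9's half-rate Cauchy route, not by print's
[15] Sect. G tree factor; the located slack `e^{6dMδ₁}` of the display (G-B12-06) sits inside `c₀(δ₁)`.
[cite: Balaban1987RG1, (4.21)–(4.22) pp.285–286; (4.3)–(4.5) pp.281–282; (1.18) p.263] -/
theorem kernelBound422_closed_lattice (hM : 0 < M) (B : Finset (Pt d)) (X : Dom B) {x₀ : Pt d}
    (hx₀ : cubeOf M x₀ ∈ X.1) (S : Finset (Pt d)) (D : PointData286 S)
    (hdjX : D.djX = treeLen X.1) (hdistX : ∀ x : S, D.distX x = (geomS B M).distD x.1 X)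
    (hdist0 : ∀ x : S, D.dist0 x = l1 (x.1 - x₀)) (hlen : ∀ x x₃ : S, D.len x x₃ = l1 (x₃.1 - x.1))
    (hδ₁ : 0 < D.δ₁) (hδ₁2 : D.δ₁ ≤ 2) (h1 : 4 * d * D.δ₁ ≤ D.δ₀) (h2 : 3 * d * M * D.δ₁ ≤ D.κ)
    (hE₁ : D.E₀ ≤ 1) (hL : 0 ≤ D.Ljη)
    {W : Type*} [NormedAddCommGroup W] [NormedSpace ℂ W]
    {E : Type*} [NormedAddCommGroup E] [NormedSpace ℂ E] [CompleteSpace E]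
    {F : Type*} [NormedAddCommGroup F] [NormedSpace ℂ F] [CompleteSpace F]
    {U : Set E} (hU : IsOpen U) (hα : 0 < D.α₂) (hαB : D.α₂ ≤ 8 * D.B₃) (hball : ball (0 : E) D.α₂ ⊆ U)
    {f : E → F} (hf : AnalyticOnNhd ℂ f U)
    (hS : ∀ y ∈ ball (0 : E) D.α₂, ‖f y‖ ≤ D.E₀ * Real.exp (-(D.κ * D.djX)))
    {UW : Set W} (hUW : IsOpen UW) {a SH K : ℝ} (ha : 0 < a) (hballW : ball (0 : W) a ⊆ UW)
    {H : W → E} (hH : AnalyticOnNhd ℂ H UW) (hSH : ∀ y ∈ ball (0 : W) a, ‖H y‖ ≤ SH) (hH0 : H 0 = 0) (hK : 0 ≤ K)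
    (Bf : S → S → Fin 4 → W) (hB0 : ∀ x x₃, ‖Bf x x₃ 0‖ ≤ D.δB x) (hB1 : ∀ x x₃, ‖Bf x x₃ 1‖ ≤ D.normB)
    (hB2 : ∀ x x₃, ‖Bf x x₃ 2‖ ≤ D.normB) (hB3 : ∀ x x₃, ‖Bf x x₃ 3‖ ≤ D.dBΓ x x₃)
    (hlocx : ∀ x x₃, ∀ y ∈ ball (0 : W) a,
      ‖fderiv ℂ H y (Bf x x₃ 0)‖ ≤ Real.exp (-(D.δ₀ * D.distX x)) * (K * ‖Bf x x₃ 0‖))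
    (hlocx₃ : ∀ x x₃, ∀ y ∈ ball (0 : W) a,
      ‖fderiv ℂ H y (Bf x x₃ 3)‖ ≤ Real.exp (-(D.δ₀ * D.distX x₃)) * (K * ‖Bf x x₃ 3‖))
    (hB₃ : max SH K * (max 1 (2 * (4 : ℝ) / a)) ^ 4 ≤ D.B₃)
    (hnormB : 0 ≤ D.normB) (hnormB' : D.normB ≤ D.α₁ * D.Ljη) (hδB' : ∀ x, D.δB x ≤ D.α₁ * D.Ljη)
    (hdBΓ' : ∀ x x₃, D.dBΓ x x₃ ≤ D.α₁ * D.Ljη ^ 2 * D.len x x₃) :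
    KernelBound422Printed
      ⟨‖∑ x, ∑ x₃, iteratedFDeriv ℂ 4 (f ∘ H) 0 (Bf x x₃)‖, D.B₃, D.α₁, D.α₂,
        Real.exp (6 * d * M * D.δ₁) * K₁ d D.δ₁, 2 / D.δ₁ * K₁ d (D.δ₁ / 2), D.κ, D.djX, D.Ljη⟩ := by
  have hE₀ : 0 ≤ D.E₀ := by
    have h1 := hS 0 (mem_ball_self hα)
    have h2 : 0 ≤ D.E₀ * Real.exp (-(D.κ * D.djX)) := (norm_nonneg _).trans h1
    by_contra h
    exact absurd h2 (not_le.2 (mul_neg_of_neg_of_pos (not_le.1 h) (Real.exp_pos _)))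
  have h1w : 2 * (d : ℝ) * D.δ₁ ≤ D.δ₀ := by
    have : 0 ≤ 2 * (d : ℝ) * D.δ₁ := by positivity
    linarith
  exact kernelBound422_actual_lattice hM B X hx₀ S D hdjX hdistX hdist0 hlen hδ₁ hδ₁2 h1w h2 hE₁ hL hU hα hαB hball hf
    hS hUW ha hballW hH hSH hH0 hK Bf hB0 hB1 hB2 hB3 hlocx hlocx₃ hB₃ hnormB hnormB' hδB' hdBΓ' fun c hc =>
      secondSum_sameBlock_actual hM B X hx₀ S D hdjX hdistX hdist0 hlen hδ₁ h1 h2 hE₀ hL hU hα hαB hball hf hS hUW ha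
        hballW hH hSH hK Bf hB0 hB1 hB2 hB3 hlocx hlocx₃ hB₃ hnormB hnormB' hδB' hdBΓ' c hc

/-- **(4.22) from the per-term bounds, `E₀` ABSORBED** (r20 g12's lemma `kernelBound422_of_terms_maxE₀`, written and checked by
the fold owner against `B12Sect4Statements` and pasted here at their request so that no importer of `B12Sect4Statements` is
rebuilt; attribution: lit-balaban-r20 gen 12, snippet sha16 193c16558a495c36) — the `E₀`-free form of r20's `kernelBound422_of_terms`:
print's (1.18) (p. 263, *"There exists a constant E₀ such that …"*) makes `E₀` an existential constant and (4.22) prints no `E₀`,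
i.e. it is absorbed into the constant named only by its symbol `c₀(δ₁)`; with `c₀' := max{1, E₀}·c₀(δ₁)` one has
`(32B₃α₁α₂⁻¹)⁴E₀c₀c₁ ≤ (32B₃α₁α₂⁻¹c₀'c₁)⁴` as soon as `1 ≤ c₀c₁` (no hypothesis `E₀ ≤ 1`).
[cite: Balaban1987RG1, (4.22) p.286; (1.18) p.263] -/
theorem kernelBound422_of_terms_maxE₀ (D : Data422) {T : Type*} (fam : Finset T) (hT : fam.card ≤ 4 ^ 4) (s : T → ℝ)
    {E₀ c₀ : ℝ} (hE₀ : 0 ≤ E₀) (hc₀ : D.c₀ = max 1 E₀ * c₀) (hc : 1 ≤ c₀ * D.c₁) (hL : 0 ≤ D.Ljη)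
    (hlhs : D.lhs2 ≤ ∑ Q ∈ fam, s Q)
    (hs : ∀ Q ∈ fam, s Q ≤
      (8 * D.B₃ * (D.α₁ / D.α₂)) ^ 4 * E₀ * c₀ * D.c₁ * Real.exp (-(1 / 3 * D.κ * D.djX)) * D.Ljη ^ 5) :
    KernelBound422Printed D := by
  have h8 : 0 ≤ (8 * D.B₃ * (D.α₁ / D.α₂)) ^ 4 := Even.pow_nonneg ⟨2, by norm_num⟩ _
  have h32 : 0 ≤ (32 * D.B₃ * (D.α₁ / D.α₂)) ^ 4 := Even.pow_nonneg ⟨2, by norm_num⟩ _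
  have hcc : 0 ≤ c₀ * D.c₁ := zero_le_one.trans hc
  have hX : 0 ≤ Real.exp (-(1 / 3 * D.κ * D.djX)) * D.Ljη ^ 5 := mul_nonneg (Real.exp_pos _).le (pow_nonneg hL _)
  have hK : 0 ≤ (8 * D.B₃ * (D.α₁ / D.α₂)) ^ 4 * E₀ * c₀ * D.c₁ * Real.exp (-(1 / 3 * D.κ * D.djX)) *
      D.Ljη ^ 5 := by
    have h := mul_nonneg (mul_nonneg (mul_nonneg h8 hE₀) hcc) hX
    calc (0 : ℝ) ≤ (8 * D.B₃ * (D.α₁ / D.α₂)) ^ 4 * E₀ * (c₀ * D.c₁) *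
        (Real.exp (-(1 / 3 * D.κ * D.djX)) * D.Ljη ^ 5) := h
      _ = _ := by ring
  have h1 := secondSum_le_of_terms fam hT s hK hlhs hs
  have hm1 : 1 ≤ max 1 E₀ := le_max_left _ _
  have hm0 : 0 ≤ max 1 E₀ := zero_le_one.trans hm1
  have hmE : E₀ ≤ max 1 E₀ := le_max_right _ _
  -- E₀ c₀ c₁ ≤ (max{1,E₀} c₀ c₁)⁴
  have hE : E₀ * (c₀ * D.c₁) ≤ (max 1 E₀ * c₀ * D.c₁) ^ 4 := by
    have hmc : 1 ≤ max 1 E₀ * (c₀ * D.c₁) := by nlinarith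
    calc E₀ * (c₀ * D.c₁) ≤ max 1 E₀ * (c₀ * D.c₁) := mul_le_mul_of_nonneg_right hmE hcc
      _ = (max 1 E₀ * (c₀ * D.c₁)) ^ 1 := by ring
      _ ≤ (max 1 E₀ * (c₀ * D.c₁)) ^ 4 := pow_le_pow_right₀ hmc (by norm_num)
      _ = (max 1 E₀ * c₀ * D.c₁) ^ 4 := by ring
  unfold KernelBound422Printed
  rw [hc₀]
  refine h1.trans ?_
  calc (32 * D.B₃ * (D.α₁ / D.α₂)) ^ 4 * E₀ * c₀ * D.c₁ * Real.exp (-(1 / 3 * D.κ * D.djX)) * D.Ljη ^ 5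
      = (32 * D.B₃ * (D.α₁ / D.α₂)) ^ 4 * (E₀ * (c₀ * D.c₁)) *
          (Real.exp (-(1 / 3 * D.κ * D.djX)) * D.Ljη ^ 5) := by ring
    _ ≤ (32 * D.B₃ * (D.α₁ / D.α₂)) ^ 4 * (max 1 E₀ * c₀ * D.c₁) ^ 4 *
          (Real.exp (-(1 / 3 * D.κ * D.djX)) * D.Ljη ^ 5) := by
        apply mul_le_mul_of_nonneg_right _ hX
        exact mul_le_mul_of_nonneg_left hE h32
    _ = (32 * D.B₃ * (D.α₁ / D.α₂) * (max 1 E₀ * c₀) * D.c₁) ^ 4 * Real.exp (-(1 / 3 * D.κ * D.djX)) *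
          D.Ljη ^ 5 := by ring

/-- **(4.22) FOR THE ACTUAL SECOND SUM OF (4.21) — CLOSED AND `E₀`-FREE** (the fold owner's head-re-lead form, r20 g12 ASK
00:27:33Z): `kernelBound422_closed_lattice` with the bookkeeping hypothesis `E₀ ≤ 1` REMOVED, the existential constant `E₀` of
(1.18) being absorbed into the lattice constant, `c₀(δ₁) := max{1, E₀}·e^{6dMδ₁}K₁(d, δ₁)` (print names `c₀(δ₁)` only by its symbol
and prints no `E₀` in (4.22)).  Hypotheses = the printed inputs only: (4.4) + (1.18); [15] Prop. 9 + `𝐇(0) = 0`; the two (190)-shape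
first-order localisation bounds; the sizes ((4.17)); `B₃ ≥ max{S_H, K}·max{1, 8/a}⁴`, `8B₃ ≥ α₂`; the lattice geometry with
`x₀ ∈ X`; *"δ₁ = O(M⁻¹)"* as `0 < δ₁ ≤ 2`, `4dδ₁ ≤ δ₀`, `3dMδ₁ ≤ κ`.  Conclusion: `KernelBound422Printed ⟨‖Σ_{x,x₃}D⁴(𝐄∘𝐇)(0)[B x x₃]‖,
B₃, α₁, α₂, max{1,E₀}·e^{6dMδ₁}K₁(d,δ₁), (2/δ₁)K₁(d,δ₁/2), κ, d_j(X), Lʲη⟩`.  (Proof text = r20 g12's validated fallback leaf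
`B12KernelBound422NoE0.draft.lean` a90846acb1f86c11, which this theorem makes moot.) [cite: Balaban1987RG1, (4.21)–(4.22) pp.285–286; (1.18) p.263] -/
theorem kernelBound422_closed_lattice_maxE₀ (hM : 0 < M) (B : Finset (Pt d)) (X : Dom B) {x₀ : Pt d}
    (hx₀ : cubeOf M x₀ ∈ X.1) (S : Finset (Pt d)) (D : PointData286 S)
    (hdjX : D.djX = treeLen X.1) (hdistX : ∀ x : S, D.distX x = (geomS B M).distD x.1 X)
    (hdist0 : ∀ x : S, D.dist0 x = l1 (x.1 - x₀)) (hlen : ∀ x x₃ : S, D.len x x₃ = l1 (x₃.1 - x.1))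
    (hδ₁ : 0 < D.δ₁) (hδ₁2 : D.δ₁ ≤ 2) (h1 : 4 * d * D.δ₁ ≤ D.δ₀) (h2 : 3 * d * M * D.δ₁ ≤ D.κ) (hL : 0 ≤ D.Ljη)
    {W : Type*} [NormedAddCommGroup W] [NormedSpace ℂ W]
    {E : Type*} [NormedAddCommGroup E] [NormedSpace ℂ E] [CompleteSpace E]
    {F : Type*} [NormedAddCommGroup F] [NormedSpace ℂ F] [CompleteSpace F]
    {U : Set E} (hU : IsOpen U) (hα : 0 < D.α₂) (hαB : D.α₂ ≤ 8 * D.B₃) (hball : ball (0 : E) D.α₂ ⊆ U)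
    {f : E → F} (hf : AnalyticOnNhd ℂ f U)
    (hS : ∀ y ∈ ball (0 : E) D.α₂, ‖f y‖ ≤ D.E₀ * Real.exp (-(D.κ * D.djX)))
    {UW : Set W} (hUW : IsOpen UW) {a SH K : ℝ} (ha : 0 < a) (hballW : ball (0 : W) a ⊆ UW)
    {H : W → E} (hH : AnalyticOnNhd ℂ H UW) (hSH : ∀ y ∈ ball (0 : W) a, ‖H y‖ ≤ SH) (hH0 : H 0 = 0) (hK : 0 ≤ K)
    (Bf : S → S → Fin 4 → W) (hB0 : ∀ x x₃, ‖Bf x x₃ 0‖ ≤ D.δB x) (hB1 : ∀ x x₃, ‖Bf x x₃ 1‖ ≤ D.normB)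
    (hB2 : ∀ x x₃, ‖Bf x x₃ 2‖ ≤ D.normB) (hB3 : ∀ x x₃, ‖Bf x x₃ 3‖ ≤ D.dBΓ x x₃)
    (hlocx : ∀ x x₃, ∀ y ∈ ball (0 : W) a,
      ‖fderiv ℂ H y (Bf x x₃ 0)‖ ≤ Real.exp (-(D.δ₀ * D.distX x)) * (K * ‖Bf x x₃ 0‖))
    (hlocx₃ : ∀ x x₃, ∀ y ∈ ball (0 : W) a,
      ‖fderiv ℂ H y (Bf x x₃ 3)‖ ≤ Real.exp (-(D.δ₀ * D.distX x₃)) * (K * ‖Bf x x₃ 3‖))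
    (hB₃ : max SH K * (max 1 (2 * (4 : ℝ) / a)) ^ 4 ≤ D.B₃)
    (hnormB : 0 ≤ D.normB) (hnormB' : D.normB ≤ D.α₁ * D.Ljη) (hδB' : ∀ x, D.δB x ≤ D.α₁ * D.Ljη)
    (hdBΓ' : ∀ x x₃, D.dBΓ x x₃ ≤ D.α₁ * D.Ljη ^ 2 * D.len x x₃) :
    KernelBound422Printed
      ⟨‖∑ x, ∑ x₃, iteratedFDeriv ℂ 4 (f ∘ H) 0 (Bf x x₃)‖, D.B₃, D.α₁, D.α₂,
        max 1 D.E₀ * (Real.exp (6 * d * M * D.δ₁) * K₁ d D.δ₁), 2 / D.δ₁ * K₁ d (D.δ₁ / 2), D.κ, D.djX, D.Ljη⟩ := by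
  have hE₀ : 0 ≤ D.E₀ := by
    have h1 := hS 0 (mem_ball_self hα)
    have h2 : 0 ≤ D.E₀ * Real.exp (-(D.κ * D.djX)) := (norm_nonneg _).trans h1
    by_contra h
    exact absurd h2 (not_le.2 (mul_neg_of_neg_of_pos (not_le.1 h) (Real.exp_pos _)))
  have h1w : 2 * (d : ℝ) * D.δ₁ ≤ D.δ₀ := by
    have : 0 ≤ 2 * (d : ℝ) * D.δ₁ := by positivity
    linarith
  have hcount : (Finset.univ : Finset (OrderedFinpartition 4)).card ≤ 4 ^ 4 := by
    rw [Finset.card_univ]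
    exact card_orderedFinpartition_le_pow 4
  -- `1 ≤ c₀(δ₁)c₁(δ₁)` for `δ₁ ≤ 2`
  have hK0 : 1 ≤ K₁ d D.δ₁ := one_le_K₁ d hδ₁
  have hK2 : 1 ≤ K₁ d (D.δ₁ / 2) := one_le_K₁ d (half_pos hδ₁)
  have hexp1 : 1 ≤ Real.exp (6 * d * M * D.δ₁) := Real.one_le_exp (by positivity)
  have hcc : 1 ≤ Real.exp (6 * d * M * D.δ₁) * K₁ d D.δ₁ * (2 / D.δ₁ * K₁ d (D.δ₁ / 2)) := by
    have h21 : 1 ≤ 2 / D.δ₁ := by rw [le_div_iff₀ hδ₁]; linarith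
    calc (1 : ℝ) = 1 * 1 * (1 * 1) := by ring
      _ ≤ Real.exp (6 * d * M * D.δ₁) * K₁ d D.δ₁ * (2 / D.δ₁ * K₁ d (D.δ₁ / 2)) :=
          mul_le_mul (mul_le_mul hexp1 hK0 zero_le_one (by positivity)) (mul_le_mul h21 hK2 zero_le_one (by positivity))
            (by positivity) (by positivity)
  refine kernelBound422_of_terms_maxE₀ _ Finset.univ hcount
    (fun c => ‖∑ x, ∑ x₃, iteratedFDeriv ℂ c.length f 0 (blockIns (𝕜 := ℂ) H 0 (Bf x x₃) c)‖)
    hE₀ rfl hcc hL ?_ ?_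
  · -- (4.3) + triangle inequality over the partitions
    show ‖∑ x, ∑ x₃, iteratedFDeriv ℂ 4 (f ∘ H) 0 (Bf x x₃)‖ ≤ _
    rw [secondSum_expansion hU hα hball hf hUW ha hballW hH hH0 Bf]
    exact norm_sum_le _ _
  · intro c _
    by_cases hc : c.index 0 = c.index 3
    · have h := secondSum_sameBlock_actual hM B X hx₀ S D hdjX hdistX hdist0 hlen hδ₁ h1 h2 hE₀ hL hU hα hαB hball
        hf hS hUW ha hballW hH hSH hK Bf hB0 hB1 hB2 hB3 hlocx hlocx₃ hB₃ hnormB hnormB' hδB' hdBΓ' c hc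
      calc _ ≤ _ := h
        _ = _ := by ring
    · have h := secondSum_differentBlocks_actual hM B X hx₀ S D hdjX hdistX hdist0 hlen hδ₁ h1w h2 hE₀ hL hU hα hαB
        hball hf hS hUW ha hballW hH hSH hK Bf hB0 hB1 hB2 hB3 hlocx hlocx₃ hB₃ hnormB hnormB' hδB' hdBΓ' c hc
      calc _ ≤ _ := h
        _ = _ := by ring

end Literature.MathematicalPhysics.QuantumFieldTheory.Balaban1983to89.B12Display286RightMember

end
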